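/-
Copyright (c) 2026 the pub-hodgecm-mathlib formalisation cell (harness21).  Prover seat hodgecm-mathlib-A-p19 (g25), 2026-09-01.  Road «S3-tree», brick T6-1r HEAD: the STABLE
germ expansion of `Φ^st(·, f; m)` along an elliptic type-(1) torus of `H_v` at a TAMELY RAMIFIED place — the ramified twin of ★ T6-1g (F0P3a-p03 (g14) p845264).
-/
import Literature.NumberTheory.Rogawski1990.RankOneStableDepthExpansionRamified          -- ★ T6-1r (this seat): `sum_smul_add_sum_smul_flip_eq` (+ the ★ R5b-PAIR theorems EDGE ∕ VERTEX in its closure)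
import Literature.NumberTheory.Rogawski1990.RankOneStableOrbitalIntegralTorus            -- ★ T6-1u′ p845235 (F0P3a-p03): the ADAPTER `stableOrbitalIntegralRel_eq_integral_add_integral_of_frame` (place-generic)
import Literature.NumberTheory.Rogawski1990.RankOneUnstableRamifiedSignedPairsTorus      -- ★ F0P3-p01 (g14) glue: `windowWeight_eq_ite`, `level_of_conj_glDiagonal_level_succ_of_v_le_one`, `coe_glDiagonal_one_unit_eq` (+ ★ cover, S2-ram, normal forms)
import Literature.NumberTheory.Rogawski1990.RankOneKappaOrbitalSupportLocalisationCM     -- ★ I-5c: `exists_sum_integral_conj_eq_of_vertexCover`, `valued_trace_le_one_of_mem_centralizer`, `mem_setOf_valued_trace_le_one_of_isLocalStablyConjH`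
import Literature.NumberTheory.Automorphic.RamifiedPlaceIntegerInvolution                -- ★ A-p19 (g23) R-0c: `exists_unitSimilitudePartner_residueBit_of_ramified`
import Literature.NumberTheory.Automorphic.RamifiedPlaceAntiFixedUniformizer             -- ★ `exists_uniformizer_galAdicCompletionMap_complexConj_eq_neg_of_ramified`
import Literature.NumberTheory.Automorphic.SelfDualStableLatticeDepthCountRamifiedCM     -- ★ A-p01 (g21) R2-E ED. 2: `exists_diagonal_unit_eigenframe_antidiagTwo_of_ramified`
import Literature.NumberTheory.Rogawski1990.RankOneTorusEigenframeTransfer               -- ★ A-p19 (g23) A-29 (a): `frameEntry_frame_of_eigenframe`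
import Literature.NumberTheory.Rogawski1990.RankOneTorusCoefficientLocalConstancy        -- ★ S3 ED. 2: `isLocallyConstant_apply_symm_frameScalar_snd_of_ne_zero`, `isLocallyConstant_finset_sum`, `isLocallyConstant_const_mul`
import Literature.NumberTheory.Rogawski1990.RankOneKappaOrbitalDepthExpansionH           -- ★ A-p13 (g32) S0: `coe_localNonsplitEquiv_mul_map_eq`
import Literature.NumberTheory.Rogawski1990.RankOneUnstableRamifiedUnitSimilitude        -- ★ A-p19 (g22) R-0: `isRegularElt_iff_frameEntry_ne`
import Literature.NumberTheory.Automorphic.ValuedFieldValuativeRelBridge                 -- ★ `v_eq_one_iff_valuation_eq_one`, `v_le_one_iff_mem_integer`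
import HarnessLib

/-!
# The STABLE germ expansion of `Φ^st(·, f; m)` along an elliptic type-(1) torus of `H_v = U(Φ₂)(L⁺_v) × U(Φ₁)(L⁺_v)` at a TAMELY RAMIFIED place, for every `f ∈ C_c^∞(H_v)`
# and every CANONICAL family `m` (Rogawski 1990 §4.9 Lemma 4.9.3, §8.1 Prop. 8.1.1; Labesse–Langlands 1979 §2 Lemma 2.1, §5)

Topic `NumberTheory/Rogawski1990`; namespace `Literature.NumberTheory.Rogawski1990`.  THEOREMS ONLY (no definition, no instance, no notation, no named fact, no `sorry`); kernel lane
`--supports stmt-HodgeConjecture-24833`.  Cell `pub/hodgecm-mathlib` (D-0151), crux H413, line «N6nsGerm» last stub `stub_N6nsS3id`; road «S3-tree», brick **T6-1r HEAD** = the H-side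
GERM TABLE, row (1)-RAMIFIED (tame), for a GENERAL test function (CENSUS-T6 F0P3a-p03 (g14) 4cc46265 §2 «(1)-ramified» ∕ §4 «T6-1r»; scope = chair T10-2 (B) «unramified + tame»,
the END CONTRACT v1's tame clause `∀ w ∣ v, |2|_w = 1`).  HONEST LABEL: HC_CM is proved only modulo the printed citations (2 remaining named inputs hLiu418 24832, h413 24833)
until rung 0 closes; this file is an ASSEMBLY over ★ material (no new arithmetic) and asserts nothing printed.

THE MATHEMATICS [Rogawski1990 Prop. 8.1.1 (germ expansion on the endoscopic group); LabesseLanglands1979 §2 Lemma 2.1 (the ramified torus), §5].  Data as ★ R-5b END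
`rankOneUnstable_core_ramified_tame` MINUS the Hecke character: a non-split `v` with ONE place `w` of `L` above it, RAMIFIED and TAME (`e(w|v) ≠ 1`, `|2|_w = 1`), a Haar measure
`ν` on `H_v`, a family `m` CANONICAL for `(Reg, ν)` with `Reg` ⊆ `U(Φ₂)`-regular, conjugation- and stably closed, `f ∈ C_c^∞(H_v)`, an elliptic type-(1) torus `Z(t₀)` framed by
`(P, d)`.  CONCLUSION: there are a level `M` and LOCALLY CONSTANT coefficient functions `Φm_0, Φm_1, Φ_0, …, Φ_{M−1} : Z(t₀) → ℂ` such that for every `t ∈ Z(t₀)` with `Reg ↑t` and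
depth `N(t) := ord_w(τ₀ t − τ₁ t) ≥ M` (then `N(t)` is ODD):
  **`Φ^st(↑t, f; m) = Σ_{π ∈ {0,1}} Φm_π(t) · 2W′_π(N(t), M) + Σ_{i<M} 2q^{⌊(N(t)−i)∕2⌋} · Φ_i(t)`**,  `W′_π(N, M) := Σ_{j ≤ N, j ≡ π (2), j + M ≤ N} w′_j`, `w′_0 = 1`, `w′_j = 2q^{⌊j∕2⌋}`
(the ★ R5b-PAIR's literal weights: ball sizes about an edge midpoint (`π = 0`, EDGE pieces `K⁰`) resp. a non-hyperspecial vertex (`π = 1`, VERTEX pieces `K♯`) of the ramified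
`(q+1, q+1)`-tree; `q = #k_v = #k_w`) — i.e. the STABLE germ of `f` along `Z(t₀)` as an explicit combination of `q`-powers with coefficients locally constant on the torus (constant
near each singular point), the ramified counterpart of ★ T6-1g's `Φm(t)·W(N−M) + Σ w_{N−i}Φ_i(t)`.  In window `i` only the pieces of parity type `π ≡ i + 1` contribute (`N` odd).
PROOF = ★ R-5b END's `obtain` chain VERBATIM minus `μ` (the one-place model `E₂`; ★ R-0c: `σ_w` on `𝒪_w`, the non-square unit `u = ↑η`, the UNIT-SIMILITUDE PARTNER `e = Ad diag(1, r)`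
with its one-place conjugation law and `hest` «stably conjugate, not conjugate»; ★ A-p01: the unit-Gram eigenframe `Q` of `E₂ t₀.1`; ★ A-29 (a): `Q` frames the whole torus; ★ an
anti-fixed uniformiser `ϖ`), then ★ F0P3-p01's glue construction with the `+` sign (★ `exists_vertexCover_of_ramified`, the PIECES ★ I-5c `exists_sum_integral_conj_eq_of_vertexCover`,
★ S2-ram common level `m₀` — window `M = m₀ + 1` so that both the plain and the `D_ϖ`-conjugated laws hold, value families ★ α1 (odd `i`, edge) ∕ ★ B-p12 (even `i`, vertex),
per piece the ★ PAIR `depthExpansion_pair_ramified_selfDual` ∕ `_modular`), then: `Φ^st(↑t, f; m) = O_ν(↑t, f) + O_ν(e ↑t, f)` (★ T6-1u′ adapter, place-generic), `= Σ_k (O_ν(↑t, φ_k) +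
O_ν(e ↑t, φ_k))` (★ I-5c at `↑t` and `e ↑t`; trace bound and properness ★ asm §2), `=` the displayed sum (★ T6-1r `sum_smul_add_sum_smul_flip_eq` per piece + §1 regrouping by
parity type, `N` odd ★ `odd_of_valuation_sub_eq_of_norm_one`); local constancy by ★ S3 `isLocallyConstant_apply_symm_frameScalar_snd_of_ne_zero`, as in the R-5b fold.

§1 `sum_pieces_eq_parityGrouped` (regrouping by parity type); §2 `stableOrbitalIntegralRel_depthExpansion_ramified` (THE H-SIDE GERM TABLE, ROW (1)-RAMIFIED (TAME), GENERAL `f`).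
References: [Rogawski1990] J. D. Rogawski, *Automorphic Representations of Unitary Groups in Three Variables*, Ann. of Math. Stud. 123 (1990): §4.9 Lemma 4.9.3 pp. 54–56; §8.1
Prop. 8.1.1 p. 112; §3.5 Prop. 3.5.2 (c) p. 29; §3.6 pp. 31–32; §4.1 (4.1.1) p. 39.  [LabesseLanglands1979] J.-P. Labesse, R. P. Langlands, *L-indistinguishability for SL(2)*, Canad.
J. Math. 31 (1979): §2 Lemma 2.1 pp. 8–9 (the ramified torus, `δ_m = 2q^m`), §5.  [Kottwitz1988] R. E. Kottwitz, *Tamagawa numbers*, Ann. of Math. 127 (1988): §2.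
-/

set_option autoImplicit false

noncomputable section

open Set Filter Topology MeasureTheory NumberField IsDedekindDomain Finset Matrix ValuativeRel Function MulAction
open scoped Matrix MatrixGroups ValuativeRel WithZero

namespace Literature.NumberTheory.Rogawski1990

open Literature.NumberTheory.Automorphic Literature.NumberTheory.Automorphic.UnitaryGroup Literature.NumberTheory.GaloisRepresentations

/-! ## §1 Algebra: regrouping the pieces by parity type -/

section Algebra
/-- **REGROUPING BY PARITY TYPE.**  Finitely many pieces `k` of parity type `par k ∈ {0,1}`, piece `k` contributing `O k = r_k • (S_{par k} • ψm_k + Σ_{i<M} c_{par k}(i) • ψ_k i (b_k i))`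
at `↑t` and `O′ k` = the same with the flipped bits `1 − b_k i` at the partner (the ★ R5b-PAIR's literal scalar ∕ window weights, `N` odd, `M ≤ N`); then
`Σ_k (O k + O′ k) = Σ_{π<2} (Σ_{k : par k = π} r_k ψm_k) · 2S_π + Σ_{i<M} 2q^{⌊(N−i)∕2⌋} · (Σ_{k : par k ≡ i+1} r_k (ψ_k i 0 + ψ_k i 1))`.
[cite: LabesseLanglands1979, §2 Lemma 2.1 p. 9] [cite: Rogawski1990, §4.9 Lemma 4.9.3 p. 56] -/
theorem sum_pieces_eq_parityGrouped {ι : Type*} [Fintype ι] (q : ℕ) {M N : ℕ} (hMN : M ≤ N) (hN : N % 2 = 1)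
    (par : ι → ℕ) (hpar : ∀ k, par k ≤ 1) (r : ι → ℝ) (ψm : ι → ℂ) (ψ : ι → ℕ → ℕ → ℂ) (O O' : ι → ℂ) (b : ι → ℕ → ℕ) (hb : ∀ k i, b k i ≤ 1)
    (hO : ∀ k, O k = r k • ((∑ j ∈ (Finset.range (N + 1)).filter (fun j => j % 2 = par k ∧ j + M ≤ N), (if j = 0 then 1 else 2 * q ^ (j / 2))) • ψm k +
      ∑ i ∈ Finset.range M, (if i ≤ N ∧ (N - i) % 2 = par k then (if N - i = 0 then 1 else 2 * q ^ ((N - i) / 2)) else 0) • ψ k i (b k i)))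
    (hO' : ∀ k, O' k = r k • ((∑ j ∈ (Finset.range (N + 1)).filter (fun j => j % 2 = par k ∧ j + M ≤ N), (if j = 0 then 1 else 2 * q ^ (j / 2))) • ψm k +
      ∑ i ∈ Finset.range M, (if i ≤ N ∧ (N - i) % 2 = par k then (if N - i = 0 then 1 else 2 * q ^ ((N - i) / 2)) else 0) • ψ k i (1 - b k i))) :
    ∑ k, (O k + O' k) =
      ∑ π ∈ Finset.range 2, (∑ k, (if par k = π then (r k : ℂ) * ψm k else 0)) *
          (((2 * ∑ j ∈ (Finset.range (N + 1)).filter (fun j => j % 2 = π ∧ j + M ≤ N), (if j = 0 then 1 else 2 * q ^ (j / 2)) : ℕ)) : ℂ) +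
        ∑ i ∈ Finset.range M, (((2 * q ^ ((N - i) / 2) : ℕ)) : ℂ) * ∑ k, (if par k = (i + 1) % 2 then (r k : ℂ) * (ψ k i 0 + ψ k i 1) else 0) := by
  classical
  -- per piece: the two sheets add up (★ T6-1r §1), weights literal ↦ `2q^{⌊(N−i)∕2⌋}` on the window (★ glue `windowWeight_eq_ite`), smul ↦ mul
  have hk : ∀ k, O k + O' k =
      (r k : ℂ) * ψm k * (((2 * ∑ j ∈ (Finset.range (N + 1)).filter (fun j => j % 2 = par k ∧ j + M ≤ N), (if j = 0 then 1 else 2 * q ^ (j / 2)) : ℕ)) : ℂ) +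
        ∑ i ∈ Finset.range M, (if par k = (i + 1) % 2 then (((2 * q ^ ((N - i) / 2) : ℕ)) : ℂ) * ((r k : ℂ) * (ψ k i 0 + ψ k i 1)) else 0) := by
    intro k
    have hflip := sum_smul_add_sum_smul_flip_eq (M := ℂ) (hb k) (Finset.range M)
      (fun i => (if i ≤ N ∧ (N - i) % 2 = par k then (if N - i = 0 then 1 else 2 * q ^ ((N - i) / 2)) else 0))
      (∑ j ∈ (Finset.range (N + 1)).filter (fun j => j % 2 = par k ∧ j + M ≤ N), (if j = 0 then 1 else 2 * q ^ (j / 2))) (ψm k) (fun i bb => ψ k i bb)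
    rw [hO k, hO' k, ← smul_add, hflip, Complex.real_smul, nsmul_eq_mul, mul_add]
    congr 1
    · push_cast; ring
    · rw [Finset.mul_sum]
      refine Finset.sum_congr rfl fun i hi => ?_
      have him : i < M := Finset.mem_range.1 hi
      have hw' := windowWeight_eq_ite q (par k) him hMN
      rw [hw', nsmul_eq_mul]
      have hmod : (N - i) % 2 = (i + 1) % 2 := by omega
      by_cases hp : par k = (i + 1) % 2
      · rw [if_pos (hmod.trans hp.symm), if_pos hp]; ring
      · rw [if_neg (fun h => hp (h.symm.trans hmod)), if_neg hp, Nat.cast_zero, zero_mul, mul_zero]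
  rw [Finset.sum_congr rfl fun k _ => hk k, Finset.sum_add_distrib]
  congr 1
  · -- scalar part: insert `Σ_{π<2} [par k = π]`
    have hπ : ∀ π ∈ Finset.range 2, (∑ k, (if par k = π then (r k : ℂ) * ψm k else 0)) *
        (((2 * ∑ j ∈ (Finset.range (N + 1)).filter (fun j => j % 2 = π ∧ j + M ≤ N), (if j = 0 then 1 else 2 * q ^ (j / 2)) : ℕ)) : ℂ) =
        ∑ k, (if par k = π then (r k : ℂ) * ψm k * (((2 * ∑ j ∈ (Finset.range (N + 1)).filter (fun j => j % 2 = π ∧ j + M ≤ N), (if j = 0 then 1 else 2 * q ^ (j / 2)) : ℕ)) : ℂ) else 0) := by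
      intro π _
      rw [Finset.sum_mul]
      exact Finset.sum_congr rfl fun k _ => by split_ifs <;> simp
    rw [Finset.sum_congr rfl hπ, Finset.sum_comm]
    refine Finset.sum_congr rfl fun k _ => ?_
    have hpk : par k ∈ Finset.range 2 := Finset.mem_range.2 (by have := hpar k; omega)
    rw [Finset.sum_ite_eq (Finset.range 2) (par k), if_pos hpk, mul_comm ((r k : ℂ) * ψm k), ← mul_assoc, mul_comm _ ((r k : ℂ))]
  · -- window part
    rw [Finset.sum_comm]
    refine Finset.sum_congr rfl fun i _ => ?_
    rw [Finset.mul_sum]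
    refine Finset.sum_congr rfl fun k _ => ?_
    split_ifs <;> simp

end Algebra

/-! ## §2 The H-side germ table, row (1)-ramified (tame), general `f` -/

section StableHead
variable (L : Type) [Field L] [NumberField L] [IsCMField L] (v : HeightOneSpectrum (𝓞 ↥(maximalRealSubfield L)))

/-- `![a, b]` is injective when `a ≠ b`. [cite: CasselsFrohlichANT1967, Ch. I §1] -/
private theorem injective_vecCons_two_T6r {Y : Type*} {a b : Y} (h : a ≠ b) : Function.Injective ![a, b] := by
  intro i j hij
  fin_cases i <;> fin_cases j
  · rfl
  · exact absurd hij h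
  · exact absurd hij.symm h
  · rfl

-- `L_w`-sized statement and a long composition: elaboration budget only (no search)
set_option maxHeartbeats 1600000 in
/-- **THE H-SIDE GERM TABLE, ROW (1)-RAMIFIED (TAME), GENERAL `f` — the STABLE depth expansion of `Φ^st(·, f; m)` along an elliptic type-(1) torus at a tamely ramified place.**
See the module docstring: with `N(t) = ord_w(τ₀ t − τ₁ t)` (odd on the deep regular locus),
`∃ M Φm Φ, (∀ π, IsLocallyConstant (Φm π)) ∧ (∀ i < M, IsLocallyConstant (Φ i)) ∧ ∀ t ∈ Z(t₀), Reg ↑t → M ≤ N(t) →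
 Φ^st(↑t, f; m) = Σ_{π<2} Φm π t · 2W′_π(N(t), M) + Σ_{i<M} 2q^{⌊(N(t)−i)∕2⌋} · Φ i t`.
[cite: Rogawski1990, §4.9 Lemma 4.9.3 pp. 54–56; §8.1 Prop. 8.1.1 p. 112; §4.1 (4.1.1) p. 39] [cite: LabesseLanglands1979, §2 Lemma 2.1 pp. 8–9, §5] [cite: Kottwitz1988, §2] -/
theorem stableOrbitalIntegralRel_depthExpansion_ramified (hv : Subsingleton (PlacesOver L v))
    (w : PlacesOver L v) (hw : IsCMField.complexConj L • w.1 = w.1)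
    (he : v.asIdeal.ramificationIdx' w.1.asIdeal ≠ 1) (h2 : Valued.v (2 : (w.1.adicCompletion L)) = 1)
    [MeasurableSpace ((cmDatum L 2 (Matrix.of fun i j : Fin 2 => if i.val + j.val + 1 = 2 then (1 : L) else 0)).Local v × (cmDatum L 1 (Matrix.of fun i j : Fin 1 => if i.val + j.val + 1 = 1 then (1 : L) else 0)).Local v)] [BorelSpace ((cmDatum L 2 (Matrix.of fun i j : Fin 2 => if i.val + j.val + 1 = 2 then (1 : L) else 0)).Local v × (cmDatum L 1 (Matrix.of fun i j : Fin 1 => if i.val + j.val + 1 = 1 then (1 : L) else 0)).Local v)] (ν : Measure ((cmDatum L 2 (Matrix.of fun i j : Fin 2 => if i.val + j.val + 1 = 2 then (1 : L) else 0)).Local v × (cmDatum L 1 (Matrix.of fun i j : Fin 1 => if i.val + j.val + 1 = 1 then (1 : L) else 0)).Local v)) [ν.IsHaarMeasure] [ν.IsMulRightInvariant]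
    [iZ : ∀ γ : ((cmDatum L 2 (Matrix.of fun i j : Fin 2 => if i.val + j.val + 1 = 2 then (1 : L) else 0)).Local v × (cmDatum L 1 (Matrix.of fun i j : Fin 1 => if i.val + j.val + 1 = 1 then (1 : L) else 0)).Local v), MeasurableSpace (((cmDatum L 2 (Matrix.of fun i j : Fin 2 => if i.val + j.val + 1 = 2 then (1 : L) else 0)).Local v × (cmDatum L 1 (Matrix.of fun i j : Fin 1 => if i.val + j.val + 1 = 1 then (1 : L) else 0)).Local v) ⧸ Subgroup.centralizer ({γ} : Set ((cmDatum L 2 (Matrix.of fun i j : Fin 2 => if i.val + j.val + 1 = 2 then (1 : L) else 0)).Local v × (cmDatum L 1 (Matrix.of fun i j : Fin 1 => if i.val + j.val + 1 = 1 then (1 : L) else 0)).Local v)))]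
    [bZ : ∀ γ : ((cmDatum L 2 (Matrix.of fun i j : Fin 2 => if i.val + j.val + 1 = 2 then (1 : L) else 0)).Local v × (cmDatum L 1 (Matrix.of fun i j : Fin 1 => if i.val + j.val + 1 = 1 then (1 : L) else 0)).Local v), BorelSpace (((cmDatum L 2 (Matrix.of fun i j : Fin 2 => if i.val + j.val + 1 = 2 then (1 : L) else 0)).Local v × (cmDatum L 1 (Matrix.of fun i j : Fin 1 => if i.val + j.val + 1 = 1 then (1 : L) else 0)).Local v) ⧸ Subgroup.centralizer ({γ} : Set ((cmDatum L 2 (Matrix.of fun i j : Fin 2 => if i.val + j.val + 1 = 2 then (1 : L) else 0)).Local v × (cmDatum L 1 (Matrix.of fun i j : Fin 1 => if i.val + j.val + 1 = 1 then (1 : L) else 0)).Local v)))]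
    (m : OrbitalMeasureFamily ((cmDatum L 2 (Matrix.of fun i j : Fin 2 => if i.val + j.val + 1 = 2 then (1 : L) else 0)).Local v × (cmDatum L 1 (Matrix.of fun i j : Fin 1 => if i.val + j.val + 1 = 1 then (1 : L) else 0)).Local v))
    (Reg : ((cmDatum L 2 (Matrix.of fun i j : Fin 2 => if i.val + j.val + 1 = 2 then (1 : L) else 0)).Local v × (cmDatum L 1 (Matrix.of fun i j : Fin 1 => if i.val + j.val + 1 = 1 then (1 : L) else 0)).Local v) → Prop) (hReg : ∀ γ, Reg γ → IsRegularElt (γ.1.val : GL (Fin 2) (LocalRing L v))) (hconj : ∀ γ x, Reg γ → Reg (x * γ * x⁻¹))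
    (hstab : ∀ γ δ, Reg γ → IsLocalStablyConjH L v γ δ → Reg δ) (hm : m.IsCanonical Reg ν)
    (f : ((cmDatum L 2 (Matrix.of fun i j : Fin 2 => if i.val + j.val + 1 = 2 then (1 : L) else 0)).Local v × (cmDatum L 1 (Matrix.of fun i j : Fin 1 => if i.val + j.val + 1 = 1 then (1 : L) else 0)).Local v) → ℂ) (hf : IsLocSmooth f)
    (t₀ : ((cmDatum L 2 (Matrix.of fun i j : Fin 2 => if i.val + j.val + 1 = 2 then (1 : L) else 0)).Local v × (cmDatum L 1 (Matrix.of fun i j : Fin 1 => if i.val + j.val + 1 = 1 then (1 : L) else 0)).Local v)) (P : GL (Fin 2) (LocalRing L v)) (d : Fin 2 → (LocalRing L v)) (ht₀ : IsRegularElt (t₀.1.val : GL (Fin 2) (LocalRing L v)))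
    (hP : (t₀.1.val.val : Matrix (Fin 2) (Fin 2) (LocalRing L v)) * P.val = P.val * Matrix.diagonal d) (hd1 : ∀ i, conjLocal L (IsCMField.complexConj L) v (d i) * d i = 1) :
    ∃ (M : ℕ) (Φm : ℕ → ↥(Subgroup.centralizer ({t₀} : Set ((cmDatum L 2 (Matrix.of fun i j : Fin 2 => if i.val + j.val + 1 = 2 then (1 : L) else 0)).Local v × (cmDatum L 1 (Matrix.of fun i j : Fin 1 => if i.val + j.val + 1 = 1 then (1 : L) else 0)).Local v))) → ℂ) (Φ : ℕ → ↥(Subgroup.centralizer ({t₀} : Set ((cmDatum L 2 (Matrix.of fun i j : Fin 2 => if i.val + j.val + 1 = 2 then (1 : L) else 0)).Local v × (cmDatum L 1 (Matrix.of fun i j : Fin 1 => if i.val + j.val + 1 = 1 then (1 : L) else 0)).Local v))) → ℂ),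
      (∀ π, IsLocallyConstant (Φm π)) ∧ (∀ i, i < M → IsLocallyConstant (Φ i)) ∧
      ∀ t : ↥(Subgroup.centralizer ({t₀} : Set ((cmDatum L 2 (Matrix.of fun i j : Fin 2 => if i.val + j.val + 1 = 2 then (1 : L) else 0)).Local v × (cmDatum L 1 (Matrix.of fun i j : Fin 1 => if i.val + j.val + 1 = 1 then (1 : L) else 0)).Local v))), Reg (t : ((cmDatum L 2 (Matrix.of fun i j : Fin 2 => if i.val + j.val + 1 = 2 then (1 : L) else 0)).Local v × (cmDatum L 1 (Matrix.of fun i j : Fin 1 => if i.val + j.val + 1 = 1 then (1 : L) else 0)).Local v)) → M ≤ (-WithZero.log (Valued.v ((((P⁻¹).val * ((t : ((cmDatum L 2 (Matrix.of fun i j : Fin 2 => if i.val + j.val + 1 = 2 then (1 : L) else 0)).Local v × (cmDatum L 1 (Matrix.of fun i j : Fin 1 => if i.val + j.val + 1 = 1 then (1 : L) else 0)).Local v)).1.val.val : Matrix (Fin 2) (Fin 2) (LocalRing L v)) * P.val) 0 0 - ((P⁻¹).val * ((t : ((cmDatum L 2 (Matrix.of fun i j : Fin 2 => if i.val + j.val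 + 1 = 2 then (1 : L) else 0)).Local v × (cmDatum L 1 (Matrix.of fun i j : Fin 1 => if i.val + j.val + 1 = 1 then (1 : L) else 0)).Local v)).1.val.val : Matrix (Fin 2) (Fin 2) (LocalRing L v)) * P.val) 1 1) w))).toNat →
        stableOrbitalIntegralRel (IsLocalStablyConjH L v) m f (t : ((cmDatum L 2 (Matrix.of fun i j : Fin 2 => if i.val + j.val + 1 = 2 then (1 : L) else 0)).Local v × (cmDatum L 1 (Matrix.of fun i j : Fin 1 => if i.val + j.val + 1 = 1 then (1 : L) else 0)).Local v)) =
          ∑ π ∈ Finset.range 2, Φm π t *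
              (((2 * ∑ j ∈ (Finset.range ((-WithZero.log (Valued.v ((((P⁻¹).val * ((t : ((cmDatum L 2 (Matrix.of fun i j : Fin 2 => if i.val + j.val + 1 = 2 then (1 : L) else 0)).Local v × (cmDatum L 1 (Matrix.of fun i j : Fin 1 => if i.val + j.val + 1 = 1 then (1 : L) else 0)).Local v)).1.val.val : Matrix (Fin 2) (Fin 2) (LocalRing L v)) * P.val) 0 0 - ((P⁻¹).val * ((t : ((cmDatum L 2 (Matrix.of fun i j : Fin 2 => if i.val + j.val + 1 = 2 then (1 : L) else 0)).Local v × (cmDatum L 1 (Matrix.of fun i j : Fin 1 => if i.val + j.val + 1 = 1 then (1 : L) else 0)).Local v)).1.val.val : Matrix (Fin 2) (Fin 2) (LocalRing L v)) * P.val) 1 1) w))).toNat + 1)).filter (fun j => j % 2 = π ∧ j + M ≤ (-WithZero.log (Valued.v ((((P⁻¹).val * ((t : ((cmDatum L 2 (Matrix.of fun i j : Fin 2 => if i.val + j.val + 1 = 2 then (1 : L) else 0)).Local v × (cmDatum L 1 (Matrix.of fun i j : Fin 1 => if i.val + j.val + 1 = 1 then (1 : L) else 0)).Local v)).1.val.val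 : Matrix (Fin 2) (Fin 2) (LocalRing L v)) * P.val) 0 0 - ((P⁻¹).val * ((t : ((cmDatum L 2 (Matrix.of fun i j : Fin 2 => if i.val + j.val + 1 = 2 then (1 : L) else 0)).Local v × (cmDatum L 1 (Matrix.of fun i j : Fin 1 => if i.val + j.val + 1 = 1 then (1 : L) else 0)).Local v)).1.val.val : Matrix (Fin 2) (Fin 2) (LocalRing L v)) * P.val) 1 1) w))).toNat), (if j = 0 then 1 else 2 * (Nat.card (𝓞 ↥(maximalRealSubfield L) ⧸ v.asIdeal)) ^ (j / 2)) : ℕ)) : ℂ) +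
            ∑ i ∈ Finset.range M, (((2 * (Nat.card (𝓞 ↥(maximalRealSubfield L) ⧸ v.asIdeal)) ^ (((-WithZero.log (Valued.v ((((P⁻¹).val * ((t : ((cmDatum L 2 (Matrix.of fun i j : Fin 2 => if i.val + j.val + 1 = 2 then (1 : L) else 0)).Local v × (cmDatum L 1 (Matrix.of fun i j : Fin 1 => if i.val + j.val + 1 = 1 then (1 : L) else 0)).Local v)).1.val.val : Matrix (Fin 2) (Fin 2) (LocalRing L v)) * P.val) 0 0 - ((P⁻¹).val * ((t : ((cmDatum L 2 (Matrix.of fun i j : Fin 2 => if i.val + j.val + 1 = 2 then (1 : L) else 0)).Local v × (cmDatum L 1 (Matrix.of fun i j : Fin 1 => if i.val + j.val + 1 = 1 then (1 : L) else 0)).Local v)).1.val.val : Matrix (Fin 2) (Fin 2) (LocalRing L v)) * P.val) 1 1) w))).toNat - i) / 2) : ℕ)) : ℂ) * Φ i t := by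
  classical
  -- §a one-place data at `w`
  obtain ⟨E₂, hE₂⟩ : ∃ E₂ : (cmDatum L 2 (Matrix.of fun i j : Fin 2 => if i.val + j.val + 1 = 2 then (1 : L) else 0)).Local v ≃ₜ* ↥(unitaryGroupOfForm (galAdicCompletionMap (L := L) (IsCMField.complexConj L) hw) (placeForm (Matrix.of fun i j : Fin 2 => if i.val + j.val + 1 = 2 then (1 : L) else 0) w.1)), ∀ g,
      ((localNonsplitEquiv (IsCMField.complexConj L) (Matrix.of fun i j : Fin 2 => if i.val + j.val + 1 = 2 then (1 : L) else 0) (IsCMField.complexConj_ne_one L) w hw g : ↥(unitaryGroupOfForm (galAdicCompletionMap (L := L) (IsCMField.complexConj L) hw) (placeForm (Matrix.of fun i j : Fin 2 => if i.val + j.val + 1 = 2 then (1 : L) else 0) w.1))) : GL (Fin 2) (w.1.adicCompletion L)) = ((E₂ g : ↥(unitaryGroupOfForm (galAdicCompletionMap (L := L) (IsCMField.complexConj L) hw) (placeForm (Matrix.of fun i j : Fin 2 => if i.val + j.val + 1 = 2 then (1 : L) else 0) w.1))) : GL (Fin 2) (w.1.adicCompletion L)) :=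
    ⟨localNonsplitEquiv (IsCMField.complexConj L) (Matrix.of fun i j : Fin 2 => if i.val + j.val + 1 = 2 then (1 : L) else 0) (IsCMField.complexConj_ne_one L) w hw, fun _ => rfl⟩
  have hE₂' : ∀ g, ((E₂ g : ↥(unitaryGroupOfForm (galAdicCompletionMap (L := L) (IsCMField.complexConj L) hw) (placeForm (Matrix.of fun i j : Fin 2 => if i.val + j.val + 1 = 2 then (1 : L) else 0) w.1))) : GL (Fin 2) (w.1.adicCompletion L)) = ((localNonsplitEquiv (IsCMField.complexConj L) (Matrix.of fun i j : Fin 2 => if i.val + j.val + 1 = 2 then (1 : L) else 0) (IsCMField.complexConj_ne_one L) w hw g : ↥(unitaryGroupOfForm (galAdicCompletionMap (L := L) (IsCMField.complexConj L) hw) (placeForm (Matrix.of fun i j : Fin 2 => if i.val + j.val + 1 = 2 then (1 : L) else 0) w.1))) : GL (Fin 2) (w.1.adicCompletion L)) :=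
    fun g => (hE₂ g).symm
  -- an anti-fixed uniformiser `ϖ` (tame ramified place)
  obtain ⟨ϖ, hϖ, hσϖ⟩ := exists_uniformizer_galAdicCompletionMap_complexConj_eq_neg_of_ramified L w hw he h2
  have hϖ0 : (ϖ : (w.1.adicCompletion L)) ≠ 0 := ϖ.ne_zero
  have hϖ' : IsUniformizingElement (ϖ : (w.1.adicCompletion L)) := isUniformizingElement_of_v_eq hϖ
  have hϖ1 : Valued.v (ϖ : (w.1.adicCompletion L)) ≤ 1 := by
    rw [hϖ, ← WithZero.exp_zero, WithZero.exp_le_exp]; norm_num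
  have hϖO : (ϖ : (w.1.adicCompletion L)) ∈ 𝒪[(w.1.adicCompletion L)] := (v_le_one_iff_mem_integer _).1 hϖ1
  have hJ : (placeForm (Matrix.of fun i j : Fin 2 => if i.val + j.val + 1 = 2 then (1 : L) else 0) w.1) = !![0, 1; 1, 0] := placeForm_antidiagTwo_eq_swap_lit L v w
  have hD := coe_glDiagonal_one_unit_eq L v w ϖ
  -- ★ R-0c: `σ_w` on `𝒪_w`, the non-square unit `u = ↑η`, the unit-similitude partner `e` with its one-place conjugation law and `hest`
  obtain ⟨σO, rL, hru, u, η, e, hσO', hσσ, hres, h2O, hηu', hηu, hση, hη, hvu, -, hAd, -, hest, -, -, hconjL, -, -⟩ :=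
    UnitaryGroup.exists_unitSimilitudePartner_residueBit_of_ramified L v w hw he h2 t₀ P d ht₀ hP hd1
  have he2 : ∀ a : ((cmDatum L 2 (Matrix.of fun i j : Fin 2 => if i.val + j.val + 1 = 2 then (1 : L) else 0)).Local v × (cmDatum L 1 (Matrix.of fun i j : Fin 1 => if i.val + j.val + 1 = 1 then (1 : L) else 0)).Local v), (e a).2 = a.2 := fun a => (hAd a).2
  have hconjE : ∀ a : ((cmDatum L 2 (Matrix.of fun i j : Fin 2 => if i.val + j.val + 1 = 2 then (1 : L) else 0)).Local v × (cmDatum L 1 (Matrix.of fun i j : Fin 1 => if i.val + j.val + 1 = 1 then (1 : L) else 0)).Local v), ((E₂ (e a).1 : ↥(unitaryGroupOfForm (galAdicCompletionMap (L := L) (IsCMField.complexConj L) hw) (placeForm (Matrix.of fun i j : Fin 2 => if i.val + j.val + 1 = 2 then (1 : L) else 0) w.1))) : GL (Fin 2) (w.1.adicCompletion L)) =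
      (glDiagonal 2 (w.1.adicCompletion L) ![1, u]) * ((E₂ a.1 : ↥(unitaryGroupOfForm (galAdicCompletionMap (L := L) (IsCMField.complexConj L) hw) (placeForm (Matrix.of fun i j : Fin 2 => if i.val + j.val + 1 = 2 then (1 : L) else 0) w.1))) : GL (Fin 2) (w.1.adicCompletion L)) * ((glDiagonal 2 (w.1.adicCompletion L) ![1, u]))⁻¹ := fun a => by
    rw [hE₂', hE₂']; exact hconjL a
  have hσu : (galAdicCompletionMap (L := L) (IsCMField.complexConj L) hw) (u : (w.1.adicCompletion L)) = u := by rw [← hηu', ← hσO', hση]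
  have hσηL : (galAdicCompletionMap (L := L) (IsCMField.complexConj L) hw) ((η : 𝒪[(w.1.adicCompletion L)]) : (w.1.adicCompletion L)) = ((η : 𝒪[(w.1.adicCompletion L)]) : (w.1.adicCompletion L)) := by rw [hηu']; exact hσu
  -- the frame of `γ := E₂ t₀.1` at `w`: `P_w`, eigenvalues `((d 0)_w, (d 1)_w)`, distinct, of norm one
  have ht₀Z : t₀ ∈ Subgroup.centralizer ({t₀} : Set ((cmDatum L 2 (Matrix.of fun i j : Fin 2 => if i.val + j.val + 1 = 2 then (1 : L) else 0)).Local v × (cmDatum L 1 (Matrix.of fun i j : Fin 1 => if i.val + j.val + 1 = 1 then (1 : L) else 0)).Local v)) := Subgroup.mem_centralizer_singleton_iff.2 rfl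
  have hτd : ∀ i : Fin 2, ((P⁻¹).val * (((⟨t₀, ht₀Z⟩ : ↥(Subgroup.centralizer ({t₀} : Set ((cmDatum L 2 (Matrix.of fun i j : Fin 2 => if i.val + j.val + 1 = 2 then (1 : L) else 0)).Local v × (cmDatum L 1 (Matrix.of fun i j : Fin 1 => if i.val + j.val + 1 = 1 then (1 : L) else 0)).Local v)))) : ((cmDatum L 2 (Matrix.of fun i j : Fin 2 => if i.val + j.val + 1 = 2 then (1 : L) else 0)).Local v × (cmDatum L 1 (Matrix.of fun i j : Fin 1 => if i.val + j.val + 1 = 1 then (1 : L) else 0)).Local v)).1.val.val : Matrix (Fin 2) (Fin 2) (LocalRing L v)) * P.val) i i = d i := by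
    intro i
    have h : (P⁻¹).val * (((⟨t₀, ht₀Z⟩ : ↥(Subgroup.centralizer ({t₀} : Set ((cmDatum L 2 (Matrix.of fun i j : Fin 2 => if i.val + j.val + 1 = 2 then (1 : L) else 0)).Local v × (cmDatum L 1 (Matrix.of fun i j : Fin 1 => if i.val + j.val + 1 = 1 then (1 : L) else 0)).Local v)))) : ((cmDatum L 2 (Matrix.of fun i j : Fin 2 => if i.val + j.val + 1 = 2 then (1 : L) else 0)).Local v × (cmDatum L 1 (Matrix.of fun i j : Fin 1 => if i.val + j.val + 1 = 1 then (1 : L) else 0)).Local v)).1.val.val : Matrix (Fin 2) (Fin 2) (LocalRing L v)) * P.val = Matrix.diagonal d := by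
      rw [Matrix.mul_assoc, show (((⟨t₀, ht₀Z⟩ : ↥(Subgroup.centralizer ({t₀} : Set ((cmDatum L 2 (Matrix.of fun i j : Fin 2 => if i.val + j.val + 1 = 2 then (1 : L) else 0)).Local v × (cmDatum L 1 (Matrix.of fun i j : Fin 1 => if i.val + j.val + 1 = 1 then (1 : L) else 0)).Local v)))) : ((cmDatum L 2 (Matrix.of fun i j : Fin 2 => if i.val + j.val + 1 = 2 then (1 : L) else 0)).Local v × (cmDatum L 1 (Matrix.of fun i j : Fin 1 => if i.val + j.val + 1 = 1 then (1 : L) else 0)).Local v)).1.val.val : Matrix (Fin 2) (Fin 2) (LocalRing L v)) = (t₀.1.val.val : Matrix (Fin 2) (Fin 2) (LocalRing L v)) from rfl, hP, ← Matrix.mul_assoc,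
        show (P⁻¹).val * P.val = 1 from P.inv_mul, Matrix.one_mul]
    rw [h, Matrix.diagonal_apply_eq]
  have hd01 : d 0 ≠ d 1 := by
    have h := (isRegularElt_iff_frameEntry_ne L v w hw t₀ P d ht₀ hP hd1 ⟨t₀, ht₀Z⟩).1 ht₀
    rwa [hτd 0, hτd 1] at h
  have hd01w : d 0 w ≠ d 1 w := fun h => hd01 ((LocalRing.eq_iff_apply_eq (IsCMField.complexConj L) (IsCMField.complexConj_ne_one L) w hw _ _).2 h)
  have hdw : Function.Injective ![d 0 w, d 1 w] := injective_vecCons_two_T6r hd01w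
  have hσw : ∀ x : LocalRing L v, conjLocal L (IsCMField.complexConj L) v x w = (galAdicCompletionMap (L := L) (IsCMField.complexConj L) hw) (x w) := fun x => conjLocal_apply_eq_galAdicCompletionMap L v w hw x
  have hd1w : ∀ i, (galAdicCompletionMap (L := L) (IsCMField.complexConj L) hw) (![d 0 w, d 1 w] i) * ![d 0 w, d 1 w] i = 1 := by
    intro i
    fin_cases i
    · have h := congrArg (fun x : LocalRing L v => x w) (hd1 0)
      simpa only [Fin.zero_eta, Fin.mk_one, Matrix.cons_val_zero, Matrix.cons_val_one, Matrix.head_cons, Pi.mul_apply, Pi.one_apply, hσw] using h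
    · have h := congrArg (fun x : LocalRing L v => x w) (hd1 1)
      simpa only [Fin.zero_eta, Fin.mk_one, Matrix.cons_val_zero, Matrix.cons_val_one, Matrix.head_cons, Pi.mul_apply, Pi.one_apply, hσw] using h
  have hPw : (((E₂ t₀.1 : ↥(unitaryGroupOfForm (galAdicCompletionMap (L := L) (IsCMField.complexConj L) hw) (placeForm (Matrix.of fun i j : Fin 2 => if i.val + j.val + 1 = 2 then (1 : L) else 0) w.1))) : GL (Fin 2) (w.1.adicCompletion L)) : Matrix (Fin 2) (Fin 2) (w.1.adicCompletion L)) * ((((Matrix.GeneralLinearGroup.map (Pi.evalRingHom (fun w' : PlacesOver L v => w'.1.adicCompletion L) w) P) : GL (Fin 2) (w.1.adicCompletion L)) : GL (Fin 2) (w.1.adicCompletion L)) : Matrix (Fin 2) (Fin 2) (w.1.adicCompletion L)) =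
      ((((Matrix.GeneralLinearGroup.map (Pi.evalRingHom (fun w' : PlacesOver L v => w'.1.adicCompletion L) w) P) : GL (Fin 2) (w.1.adicCompletion L)) : GL (Fin 2) (w.1.adicCompletion L)) : Matrix (Fin 2) (Fin 2) (w.1.adicCompletion L)) * diagonal ![d 0 w, d 1 w] := by
    have h := coe_localNonsplitEquiv_mul_map_eq L v w hw t₀.1 P (Matrix.diagonal d) hP
    rw [hE₂', h, Matrix.diagonal_map (map_zero _)]
    congr 1
    funext i
    fin_cases i <;> rfl
  -- ★ A-p01: the UNIT-GRAM EIGENFRAME `Q` of `E₂ t₀.1`, framing the whole torus (★ A-29 (a))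
  obtain ⟨Q, h, rQ, hQ₀, hhv, hσh, hQh, hr, hsq⟩ :=
    exists_diagonal_unit_eigenframe_antidiagTwo_of_ramified L v w hw he h2 σO hσO' hres (E₂ t₀.1).2 hPw hdw hd1w
  have hh : ∀ i, Valued.v (h i) = 1 := fun i => (v_eq_one_iff_valuation_eq_one (h i)).2 (hhv i)
  have hQ := frameEntry_frame_of_eigenframe L v w hw t₀ P d ht₀ hP hd1 E₂ hE₂' Q hQ₀
  -- §b the vertex cover at the ramified place and the PIECES of `f` (★ I-5a-ram, ★ I-5c)
  obtain ⟨K₂, -, hd0, hd1', hK₂o, hK₂c, hcov⟩ := exists_vertexCover_of_ramified L v w hw he h2 ϖ hϖ hσϖ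
  obtain ⟨n, ε, φk, hφk, hφkK, hφkinv, hint⟩ := exists_sum_integral_conj_eq_of_vertexCover L v w hw ν K₂ hK₂o hK₂c hcov hf
  have hdict0 : ∀ g, g ∈ K₂ 0 ↔ E₂ g ∈ ((glInt 2 (w.1.adicCompletion L)).subgroupOf (unitaryGroupOfForm (galAdicCompletionMap (L := L) (IsCMField.complexConj L) hw) (placeForm (Matrix.of fun i j : Fin 2 => if i.val + j.val + 1 = 2 then (1 : L) else 0) w.1))) := fun g => by
    rw [Subgroup.mem_subgroupOf, hE₂']; exact hd0 g
  have hdict1 : ∀ g, g ∈ K₂ 1 ↔ E₂ g ∈ (((glInt 2 (w.1.adicCompletion L)).map (MulAut.conj (glDiagonal 2 (w.1.adicCompletion L) ![1, ϖ])).toMonoidHom).subgroupOf (unitaryGroupOfForm (galAdicCompletionMap (L := L) (IsCMField.complexConj L) hw) (placeForm (Matrix.of fun i j : Fin 2 => if i.val + j.val + 1 = 2 then (1 : L) else 0) w.1))) := fun g => by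
    rw [Subgroup.mem_subgroupOf, hE₂']; exact hd1' g
  have hε : ∀ k, ε k = 0 ∨ ε k = 1 := by
    intro k
    generalize ε k = x
    fin_cases x <;> simp
  -- §c ★ S2-ram: the common level `m₀`; window `m₀ + 1` (plain AND `D_ϖ`-conjugated laws one step up)
  obtain ⟨m₀, -, hKm₀, hφm₀⟩ := exists_level_data_onePlace_of_v_eq L v w hw hϖ E₂ φk (fun k => (hφk k).1) (fun k => (hφk k).2)
  have hKmE : ∀ y : ↥(unitaryGroupOfForm (galAdicCompletionMap (L := L) (IsCMField.complexConj L) hw) (placeForm (Matrix.of fun i j : Fin 2 => if i.val + j.val + 1 = 2 then (1 : L) else 0) w.1)), (∀ r s, (ϖ : (w.1.adicCompletion L)) ^ (-((m₀ + 1 : ℕ) : ℤ)) * ((((y : ↥(unitaryGroupOfForm (galAdicCompletionMap (L := L) (IsCMField.complexConj L) hw) (placeForm (Matrix.of fun i j : Fin 2 => if i.val + j.val + 1 = 2 then (1 : L) else 0) w.1))) : GL (Fin 2) (w.1.adicCompletion L)) : Matrix (Fin 2) (Fin 2) (w.1.adicCompletion L)) - 1) r s ∈ 𝒪[(w.1.adicCompletion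 L)]) →
      y ∈ (localCongruenceSubgroup 2 L w.1 m₀).subgroupOf (unitaryGroupOfForm (galAdicCompletionMap (L := L) (IsCMField.complexConj L) hw) (placeForm (Matrix.of fun i j : Fin 2 => if i.val + j.val + 1 = 2 then (1 : L) else 0) w.1)) := fun y hy =>
    hKm₀ y (fun r s => depthPred_anti hϖ' _ (Nat.le_succ m₀) hy r s)
  have hKmV : ∀ y : ↥(unitaryGroupOfForm (galAdicCompletionMap (L := L) (IsCMField.complexConj L) hw) (placeForm (Matrix.of fun i j : Fin 2 => if i.val + j.val + 1 = 2 then (1 : L) else 0) w.1)), (∀ r s, (ϖ : (w.1.adicCompletion L)) ^ (-((m₀ + 1 : ℕ) : ℤ)) *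
      (((((glDiagonal 2 (w.1.adicCompletion L) ![1, ϖ])⁻¹ * ((y : ↥(unitaryGroupOfForm (galAdicCompletionMap (L := L) (IsCMField.complexConj L) hw) (placeForm (Matrix.of fun i j : Fin 2 => if i.val + j.val + 1 = 2 then (1 : L) else 0) w.1))) : GL (Fin 2) (w.1.adicCompletion L)) * (glDiagonal 2 (w.1.adicCompletion L) ![1, ϖ]) : GL (Fin 2) (w.1.adicCompletion L))) : Matrix (Fin 2) (Fin 2) (w.1.adicCompletion L)) - 1) r s ∈ 𝒪[(w.1.adicCompletion L)]) →
      y ∈ (localCongruenceSubgroup 2 L w.1 m₀).subgroupOf (unitaryGroupOfForm (galAdicCompletionMap (L := L) (IsCMField.complexConj L) hw) (placeForm (Matrix.of fun i j : Fin 2 => if i.val + j.val + 1 = 2 then (1 : L) else 0) w.1)) := fun y hy =>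
    hKm₀ y (level_of_conj_glDiagonal_level_succ_of_v_le_one L v w ϖ hϖ1 ((y : ↥(unitaryGroupOfForm (galAdicCompletionMap (L := L) (IsCMField.complexConj L) hw) (placeForm (Matrix.of fun i j : Fin 2 => if i.val + j.val + 1 = 2 then (1 : L) else 0) w.1))) : GL (Fin 2) (w.1.adicCompletion L)) hy)
  have hS3 : ∀ (k : Fin n) (x : ((cmDatum L 2 (Matrix.of fun i j : Fin 2 => if i.val + j.val + 1 = 2 then (1 : L) else 0)).Local v × (cmDatum L 1 (Matrix.of fun i j : Fin 1 => if i.val + j.val + 1 = 1 then (1 : L) else 0)).Local v)) (y : ↥(unitaryGroupOfForm (galAdicCompletionMap (L := L) (IsCMField.complexConj L) hw) (placeForm (Matrix.of fun i j : Fin 2 => if i.val + j.val + 1 = 2 then (1 : L) else 0) w.1))), (∀ r s, (ϖ : (w.1.adicCompletion L)) ^ (-((m₀ + 1 : ℕ) : ℤ)) * ((((y : ↥(unitaryGroupOfForm (galAdicCompletionMap (L := L) (IsCMField.complexConj L) hw) (placeForm (Matrix.of fun i j : Fin 2 => if i.val + j.val + 1 = 2 then (1 : L) else 0) w.1))) :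 GL (Fin 2) (w.1.adicCompletion L)) : Matrix (Fin 2) (Fin 2) (w.1.adicCompletion L)) - 1) r s ∈ 𝒪[(w.1.adicCompletion L)]) →
      φk k (x * (E₂.symm y, 1)) = φk k x := by
    intro k x y hy
    have h := hφm₀ k x.2 (E₂ x.1) y (hKmE y hy)
    rw [map_mul, ContinuousMulEquiv.symm_apply_apply] at h
    have hx : x * (E₂.symm y, 1) = (x.1 * E₂.symm y, x.2) := Prod.ext rfl (mul_one _)
    rw [hx]
    exact h
  -- §d value families along the torus (★ α1 on odd `i`, ★ B-p12 rider on even `i`, the scalar element elsewhere)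
  have hcw : ∀ t : ↥(Subgroup.centralizer ({t₀} : Set ((cmDatum L 2 (Matrix.of fun i j : Fin 2 => if i.val + j.val + 1 = 2 then (1 : L) else 0)).Local v × (cmDatum L 1 (Matrix.of fun i j : Fin 1 => if i.val + j.val + 1 = 1 then (1 : L) else 0)).Local v))), (galAdicCompletionMap (L := L) (IsCMField.complexConj L) hw) ((((P⁻¹).val * ((t : ((cmDatum L 2 (Matrix.of fun i j : Fin 2 => if i.val + j.val + 1 = 2 then (1 : L) else 0)).Local v × (cmDatum L 1 (Matrix.of fun i j : Fin 1 => if i.val + j.val + 1 = 1 then (1 : L) else 0)).Local v)).1.val.val : Matrix (Fin 2) (Fin 2) (LocalRing L v)) * P.val) 1 1) w) * ((((P⁻¹).val * ((t : ((cmDatum L 2 (Matrix.of fun i j : Fin 2 => if i.val + j.val + 1 = 2 then (1 : L) else 0)).Local v × (cmDatum L 1 (Matrix.of fun i j : Fin 1 => if i.val + j.val + 1 = 1 then (1 : L) else 0)).Local v)).1.val.val : Matrix (Fin 2) (Fin 2) (LocalRing L v)) * P.val) 1 1) w) = 1 := fun t => by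
    have h := congrArg (fun x : LocalRing L v => x w) (conjLocal_frameEntry_mul_self_apply L v w hw t₀ P d ht₀ hP hd1 t 1)
    simpa only [Pi.mul_apply, Pi.one_apply, conjLocal_apply_eq_galAdicCompletionMap L v w hw] using h
  have hcv : ∀ t : ↥(Subgroup.centralizer ({t₀} : Set ((cmDatum L 2 (Matrix.of fun i j : Fin 2 => if i.val + j.val + 1 = 2 then (1 : L) else 0)).Local v × (cmDatum L 1 (Matrix.of fun i j : Fin 1 => if i.val + j.val + 1 = 1 then (1 : L) else 0)).Local v))), valuation (w.1.adicCompletion L) ((((P⁻¹).val * ((t : ((cmDatum L 2 (Matrix.of fun i j : Fin 2 => if i.val + j.val + 1 = 2 then (1 : L) else 0)).Local v × (cmDatum L 1 (Matrix.of fun i j : Fin 1 => if i.val + j.val + 1 = 1 then (1 : L) else 0)).Local v)).1.val.val : Matrix (Fin 2) (Fin 2) (LocalRing L v)) * P.val) 1 1) w) = 1 := fun t => valuation_eq_one_of_galAdicCompletionMap_mul_self L v w hw (hcw t)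
  have hexE : ∀ t : ↥(Subgroup.centralizer ({t₀} : Set ((cmDatum L 2 (Matrix.of fun i j : Fin 2 => if i.val + j.val + 1 = 2 then (1 : L) else 0)).Local v × (cmDatum L 1 (Matrix.of fun i j : Fin 1 => if i.val + j.val + 1 = 1 then (1 : L) else 0)).Local v))), ∃ (xm : ↥(unitaryGroupOfForm (galAdicCompletionMap (L := L) (IsCMField.complexConj L) hw) (placeForm (Matrix.of fun i j : Fin 2 => if i.val + j.val + 1 = 2 then (1 : L) else 0) w.1))) (x : ℕ → ℕ → ↥(unitaryGroupOfForm (galAdicCompletionMap (L := L) (IsCMField.complexConj L) hw) (placeForm (Matrix.of fun i j : Fin 2 => if i.val + j.val + 1 = 2 then (1 : L) else 0) w.1))), (((xm : ↥(unitaryGroupOfForm (galAdicCompletionMap (L := L) (IsCMField.complexConj L) hw) (placeForm (Matrix.of fun i j : Fin 2 => if i.val + j.val + 1 = 2 then (1 : L) else 0) w.1))) : GL (Fin 2) (w.1.adicCompletion L)) : Matrix (Fin 2) (Fin 2) (w.1.adicCompletion L)) = ((((P⁻¹).val * ((t : ((cmDatum L 2 (Matrix.of fun i j : Fin 2 =>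 if i.val + j.val + 1 = 2 then (1 : L) else 0)).Local v × (cmDatum L 1 (Matrix.of fun i j : Fin 1 => if i.val + j.val + 1 = 1 then (1 : L) else 0)).Local v)).1.val.val : Matrix (Fin 2) (Fin 2) (LocalRing L v)) * P.val) 1 1) w) • (1 : Matrix (Fin 2) (Fin 2) (w.1.adicCompletion L)) ∧
      ∀ i b, Odd i → (((x i b : ↥(unitaryGroupOfForm (galAdicCompletionMap (L := L) (IsCMField.complexConj L) hw) (placeForm (Matrix.of fun i j : Fin 2 => if i.val + j.val + 1 = 2 then (1 : L) else 0) w.1))) : GL (Fin 2) (w.1.adicCompletion L)) : Matrix (Fin 2) (Fin 2) (w.1.adicCompletion L)) = ((((P⁻¹).val * ((t : ((cmDatum L 2 (Matrix.of fun i j : Fin 2 => if i.val + j.val + 1 = 2 then (1 : L) else 0)).Local v × (cmDatum L 1 (Matrix.of fun i j : Fin 1 => if i.val + j.val + 1 = 1 then (1 : L) else 0)).Local v)).1.val.val : Matrix (Fin 2) (Fin 2) (LocalRing L v)) * P.val) 1 1) w) • ((1 : Matrix (Fin 2) (Fin 2) (w.1.adicCompletion L)) + (ϖ : (w.1.adicCompletion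 L)) ^ i • !![0, ((η : 𝒪[(w.1.adicCompletion L)]) : (w.1.adicCompletion L)) ^ b; 0, 0]) := fun t => by
    obtain ⟨xm, x, -, -, hxm, -, hx, -⟩ := exists_unitary_signedNormalForm_elements (galAdicCompletionMap (L := L) (IsCMField.complexConj L) hw) (placeForm (Matrix.of fun i j : Fin 2 => if i.val + j.val + 1 = 2 then (1 : L) else 0) w.1) hJ (hcw t) (hcv t) hσϖ hϖO hσηL η.2
    exact ⟨xm, x, hxm, hx⟩
  choose xm xE hxm hxE using hexE
  have hexV : ∀ t : ↥(Subgroup.centralizer ({t₀} : Set ((cmDatum L 2 (Matrix.of fun i j : Fin 2 => if i.val + j.val + 1 = 2 then (1 : L) else 0)).Local v × (cmDatum L 1 (Matrix.of fun i j : Fin 1 => if i.val + j.val + 1 = 1 then (1 : L) else 0)).Local v))), ∃ x : ℕ → ℕ → ↥(unitaryGroupOfForm (galAdicCompletionMap (L := L) (IsCMField.complexConj L) hw) (placeForm (Matrix.of fun i j : Fin 2 => if i.val + j.val + 1 = 2 then (1 : L) else 0) w.1)),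
      ∀ i b, Even i → (((x i b : ↥(unitaryGroupOfForm (galAdicCompletionMap (L := L) (IsCMField.complexConj L) hw) (placeForm (Matrix.of fun i j : Fin 2 => if i.val + j.val + 1 = 2 then (1 : L) else 0) w.1))) : GL (Fin 2) (w.1.adicCompletion L)) : Matrix (Fin 2) (Fin 2) (w.1.adicCompletion L)) = ((((P⁻¹).val * ((t : ((cmDatum L 2 (Matrix.of fun i j : Fin 2 => if i.val + j.val + 1 = 2 then (1 : L) else 0)).Local v × (cmDatum L 1 (Matrix.of fun i j : Fin 1 => if i.val + j.val + 1 = 1 then (1 : L) else 0)).Local v)).1.val.val : Matrix (Fin 2) (Fin 2) (LocalRing L v)) * P.val) 1 1) w) • ((1 : Matrix (Fin 2) (Fin 2) (w.1.adicCompletion L)) + (ϖ : (w.1.adicCompletion L)) ^ i •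
        ((((glDiagonal 2 (w.1.adicCompletion L) ![1, ϖ]) : GL (Fin 2) (w.1.adicCompletion L)) : Matrix (Fin 2) (Fin 2) (w.1.adicCompletion L)) * !![0, ((η : 𝒪[(w.1.adicCompletion L)]) : (w.1.adicCompletion L)) ^ b; 0, 0] * ((((glDiagonal 2 (w.1.adicCompletion L) ![1, ϖ]))⁻¹ : GL (Fin 2) (w.1.adicCompletion L)) : Matrix (Fin 2) (Fin 2) (w.1.adicCompletion L)))) := fun t => by
    obtain ⟨_, x, -, -, -, -, hx, -⟩ := exists_conj_signedNormalForm_elements_modular (galAdicCompletionMap (L := L) (IsCMField.complexConj L) hw) (placeForm (Matrix.of fun i j : Fin 2 => if i.val + j.val + 1 = 2 then (1 : L) else 0) w.1) hJ (glDiagonal 2 (w.1.adicCompletion L) ![1, ϖ]) hD (hcw t) (hcv t) hσϖ hϖO hσηL η.2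
    exact ⟨x, hx⟩
  choose xV hxV using hexV
  obtain ⟨XE, hXE⟩ : ∃ XE : ↥(Subgroup.centralizer ({t₀} : Set ((cmDatum L 2 (Matrix.of fun i j : Fin 2 => if i.val + j.val + 1 = 2 then (1 : L) else 0)).Local v × (cmDatum L 1 (Matrix.of fun i j : Fin 1 => if i.val + j.val + 1 = 1 then (1 : L) else 0)).Local v))) → ℕ → ℕ → ↥(unitaryGroupOfForm (galAdicCompletionMap (L := L) (IsCMField.complexConj L) hw) (placeForm (Matrix.of fun i j : Fin 2 => if i.val + j.val + 1 = 2 then (1 : L) else 0) w.1)), ∀ t i b, XE t i b = if Odd i then xE t i b else xm t := ⟨_, fun _ _ _ => rfl⟩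
  obtain ⟨XV, hXV⟩ : ∃ XV : ↥(Subgroup.centralizer ({t₀} : Set ((cmDatum L 2 (Matrix.of fun i j : Fin 2 => if i.val + j.val + 1 = 2 then (1 : L) else 0)).Local v × (cmDatum L 1 (Matrix.of fun i j : Fin 1 => if i.val + j.val + 1 = 1 then (1 : L) else 0)).Local v))) → ℕ → ℕ → ↥(unitaryGroupOfForm (galAdicCompletionMap (L := L) (IsCMField.complexConj L) hw) (placeForm (Matrix.of fun i j : Fin 2 => if i.val + j.val + 1 = 2 then (1 : L) else 0) w.1)), ∀ t i b, XV t i b = if Even i then xV t i b else xm t := ⟨_, fun _ _ _ => rfl⟩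
  have hXE' : ∀ t i b, Odd i → (((XE t i b : ↥(unitaryGroupOfForm (galAdicCompletionMap (L := L) (IsCMField.complexConj L) hw) (placeForm (Matrix.of fun i j : Fin 2 => if i.val + j.val + 1 = 2 then (1 : L) else 0) w.1))) : GL (Fin 2) (w.1.adicCompletion L)) : Matrix (Fin 2) (Fin 2) (w.1.adicCompletion L)) = ((((P⁻¹).val * ((t : ((cmDatum L 2 (Matrix.of fun i j : Fin 2 => if i.val + j.val + 1 = 2 then (1 : L) else 0)).Local v × (cmDatum L 1 (Matrix.of fun i j : Fin 1 => if i.val + j.val + 1 = 1 then (1 : L) else 0)).Local v)).1.val.val : Matrix (Fin 2) (Fin 2) (LocalRing L v)) * P.val) 1 1) w) • ((1 : Matrix (Fin 2) (Fin 2) (w.1.adicCompletion L)) + (ϖ : (w.1.adicCompletion L)) ^ i • !![0, ((η : 𝒪[(w.1.adicCompletion L)]) : (w.1.adicCompletion L)) ^ b; 0, 0]) :=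
    fun t i b hi => by rw [hXE, if_pos hi]; exact hxE t i b hi
  have hXV' : ∀ t i b, Even i → (((XV t i b : ↥(unitaryGroupOfForm (galAdicCompletionMap (L := L) (IsCMField.complexConj L) hw) (placeForm (Matrix.of fun i j : Fin 2 => if i.val + j.val + 1 = 2 then (1 : L) else 0) w.1))) : GL (Fin 2) (w.1.adicCompletion L)) : Matrix (Fin 2) (Fin 2) (w.1.adicCompletion L)) = ((((P⁻¹).val * ((t : ((cmDatum L 2 (Matrix.of fun i j : Fin 2 => if i.val + j.val + 1 = 2 then (1 : L) else 0)).Local v × (cmDatum L 1 (Matrix.of fun i j : Fin 1 => if i.val + j.val + 1 = 1 then (1 : L) else 0)).Local v)).1.val.val : Matrix (Fin 2) (Fin 2) (LocalRing L v)) * P.val) 1 1) w) • ((1 : Matrix (Fin 2) (Fin 2) (w.1.adicCompletion L)) + (ϖ : (w.1.adicCompletion L)) ^ i •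
      ((((glDiagonal 2 (w.1.adicCompletion L) ![1, ϖ]) : GL (Fin 2) (w.1.adicCompletion L)) : Matrix (Fin 2) (Fin 2) (w.1.adicCompletion L)) * !![0, ((η : 𝒪[(w.1.adicCompletion L)]) : (w.1.adicCompletion L)) ^ b; 0, 0] * ((((glDiagonal 2 (w.1.adicCompletion L) ![1, ϖ]))⁻¹ : GL (Fin 2) (w.1.adicCompletion L)) : Matrix (Fin 2) (Fin 2) (w.1.adicCompletion L)))) :=
    fun t i b hi => by rw [hXV, if_pos hi]; exact hxV t i b hi
  -- the matrices behind the value families (for ★ S3's local constancy): scalar, edge window, vertex window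
  obtain ⟨ME, hME⟩ : ∃ ME : ℕ → ℕ → Matrix (Fin 2) (Fin 2) (w.1.adicCompletion L), ∀ i b, ME i b = if Odd i then ((1 : Matrix (Fin 2) (Fin 2) (w.1.adicCompletion L)) + (ϖ : (w.1.adicCompletion L)) ^ i • !![0, ((η : 𝒪[(w.1.adicCompletion L)]) : (w.1.adicCompletion L)) ^ b; 0, 0]) else 1 :=
    ⟨_, fun _ _ => rfl⟩
  obtain ⟨MV, hMV⟩ : ∃ MV : ℕ → ℕ → Matrix (Fin 2) (Fin 2) (w.1.adicCompletion L), ∀ i b, MV i b = if Even i then ((1 : Matrix (Fin 2) (Fin 2) (w.1.adicCompletion L)) + (ϖ : (w.1.adicCompletion L)) ^ i •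
      ((((glDiagonal 2 (w.1.adicCompletion L) ![1, ϖ]) : GL (Fin 2) (w.1.adicCompletion L)) : Matrix (Fin 2) (Fin 2) (w.1.adicCompletion L)) * !![0, ((η : 𝒪[(w.1.adicCompletion L)]) : (w.1.adicCompletion L)) ^ b; 0, 0] * ((((glDiagonal 2 (w.1.adicCompletion L) ![1, ϖ]))⁻¹ : GL (Fin 2) (w.1.adicCompletion L)) : Matrix (Fin 2) (Fin 2) (w.1.adicCompletion L)))) else 1 :=
    ⟨_, fun _ _ => rfl⟩
  have hXEM : ∀ t i b, (((XE t i b : ↥(unitaryGroupOfForm (galAdicCompletionMap (L := L) (IsCMField.complexConj L) hw) (placeForm (Matrix.of fun i j : Fin 2 => if i.val + j.val + 1 = 2 then (1 : L) else 0) w.1))) : GL (Fin 2) (w.1.adicCompletion L)) : Matrix (Fin 2) (Fin 2) (w.1.adicCompletion L)) = ((((P⁻¹).val * ((t : ((cmDatum L 2 (Matrix.of fun i j : Fin 2 => if i.val + j.val + 1 = 2 then (1 : L) else 0)).Local v × (cmDatum L 1 (Matrix.of fun i j : Fin 1 => if i.val + j.val + 1 = 1 then (1 : L) else 0)).Local v)).1.val.val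 : Matrix (Fin 2) (Fin 2) (LocalRing L v)) * P.val) 1 1) w) • ME i b := fun t i b => by
    rw [hME]
    by_cases hi : Odd i
    · rw [if_pos hi]; exact hXE' t i b hi
    · rw [if_neg hi, hXE, if_neg hi]; exact hxm t
  have hXVM : ∀ t i b, (((XV t i b : ↥(unitaryGroupOfForm (galAdicCompletionMap (L := L) (IsCMField.complexConj L) hw) (placeForm (Matrix.of fun i j : Fin 2 => if i.val + j.val + 1 = 2 then (1 : L) else 0) w.1))) : GL (Fin 2) (w.1.adicCompletion L)) : Matrix (Fin 2) (Fin 2) (w.1.adicCompletion L)) = ((((P⁻¹).val * ((t : ((cmDatum L 2 (Matrix.of fun i j : Fin 2 => if i.val + j.val + 1 = 2 then (1 : L) else 0)).Local v × (cmDatum L 1 (Matrix.of fun i j : Fin 1 => if i.val + j.val + 1 = 1 then (1 : L) else 0)).Local v)).1.val.val : Matrix (Fin 2) (Fin 2) (LocalRing L v)) * P.val) 1 1) w) • MV i b := fun t i b => by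
    rw [hMV]
    by_cases hi : Even i
    · rw [if_pos hi]; exact hXV' t i b hi
    · rw [if_neg hi, hXV, if_neg hi]; exact hxm t
  -- the depth is ODD on the deep regular locus (★ α4 frame at `w` + ★ parity rider)
  have hNodd : ∀ t : ↥(Subgroup.centralizer ({t₀} : Set ((cmDatum L 2 (Matrix.of fun i j : Fin 2 => if i.val + j.val + 1 = 2 then (1 : L) else 0)).Local v × (cmDatum L 1 (Matrix.of fun i j : Fin 1 => if i.val + j.val + 1 = 1 then (1 : L) else 0)).Local v))), IsRegularElt ((t : ((cmDatum L 2 (Matrix.of fun i j : Fin 2 => if i.val + j.val + 1 = 2 then (1 : L) else 0)).Local v × (cmDatum L 1 (Matrix.of fun i j : Fin 1 => if i.val + j.val + 1 = 1 then (1 : L) else 0)).Local v)).1.val : GL (Fin 2) (LocalRing L v)) → m₀ + 1 ≤ (-WithZero.log (Valued.v ((((P⁻¹).val * ((t : ((cmDatum L 2 (Matrix.of fun i j : Fin 2 => if i.val + j.val + 1 = 2 then (1 : L) else 0)).Local v × (cmDatum L 1 (Matrix.of fun i j : Fin 1 => if i.val + j.val + 1 = 1 then (1 : L) else 0)).Local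 v)).1.val.val : Matrix (Fin 2) (Fin 2) (LocalRing L v)) * P.val) 0 0 - ((P⁻¹).val * ((t : ((cmDatum L 2 (Matrix.of fun i j : Fin 2 => if i.val + j.val + 1 = 2 then (1 : L) else 0)).Local v × (cmDatum L 1 (Matrix.of fun i j : Fin 1 => if i.val + j.val + 1 = 1 then (1 : L) else 0)).Local v)).1.val.val : Matrix (Fin 2) (Fin 2) (LocalRing L v)) * P.val) 1 1) w))).toNat → (-WithZero.log (Valued.v ((((P⁻¹).val * ((t : ((cmDatum L 2 (Matrix.of fun i j : Fin 2 => if i.val + j.val + 1 = 2 then (1 : L) else 0)).Local v × (cmDatum L 1 (Matrix.of fun i j : Fin 1 => if i.val + j.val + 1 = 1 then (1 : L) else 0)).Local v)).1.val.val : Matrix (Fin 2) (Fin 2) (LocalRing L v)) * P.val) 0 0 - ((P⁻¹).val * ((t : ((cmDatum L 2 (Matrix.of fun i j : Fin 2 => if i.val + j.val + 1 = 2 then (1 : L) else 0)).Local v × (cmDatum L 1 (Matrix.of fun i j : Fin 1 => if i.val + j.val + 1 = 1 then (1 : L) else 0)).Local v)).1.val.val : Matrix (Fin 2) (Fin 2)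 (LocalRing L v)) * P.val) 1 1) w))).toNat % 2 = 1 := fun t hreg hmN => by
    obtain ⟨-, -, hu1, hn⟩ := frame_onePlace_of_mem_centralizer_of_v_eq L v w hw t₀ P d ht₀ hP hd1 (ϖ : (w.1.adicCompletion L)) hϖ E₂ hE₂' t hreg
    have hval : ∀ i, valuation (w.1.adicCompletion L) ((![(((P⁻¹).val * ((t : ((cmDatum L 2 (Matrix.of fun i j : Fin 2 => if i.val + j.val + 1 = 2 then (1 : L) else 0)).Local v × (cmDatum L 1 (Matrix.of fun i j : Fin 1 => if i.val + j.val + 1 = 1 then (1 : L) else 0)).Local v)).1.val.val : Matrix (Fin 2) (Fin 2) (LocalRing L v)) * P.val) 0 0) w, (((P⁻¹).val * ((t : ((cmDatum L 2 (Matrix.of fun i j : Fin 2 => if i.val + j.val + 1 = 2 then (1 : L) else 0)).Local v × (cmDatum L 1 (Matrix.of fun i j : Fin 1 => if i.val + j.val + 1 = 1 then (1 : L) else 0)).Local v)).1.val.val : Matrix (Fin 2) (Fin 2) (LocalRing L v)) * P.val) 1 1) w] : Fin 2 → (w.1.adicCompletion L)) i) = 1 := fun i =>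
      valuation_eq_one_of_galAdicCompletionMap_mul_self L v w hw (hu1 i)
    have hN' : valuation (w.1.adicCompletion L) ((![(((P⁻¹).val * ((t : ((cmDatum L 2 (Matrix.of fun i j : Fin 2 => if i.val + j.val + 1 = 2 then (1 : L) else 0)).Local v × (cmDatum L 1 (Matrix.of fun i j : Fin 1 => if i.val + j.val + 1 = 1 then (1 : L) else 0)).Local v)).1.val.val : Matrix (Fin 2) (Fin 2) (LocalRing L v)) * P.val) 0 0) w, (((P⁻¹).val * ((t : ((cmDatum L 2 (Matrix.of fun i j : Fin 2 => if i.val + j.val + 1 = 2 then (1 : L) else 0)).Local v × (cmDatum L 1 (Matrix.of fun i j : Fin 1 => if i.val + j.val + 1 = 1 then (1 : L) else 0)).Local v)).1.val.val : Matrix (Fin 2) (Fin 2) (LocalRing L v)) * P.val) 1 1) w] : Fin 2 → (w.1.adicCompletion L)) 0 - (![(((P⁻¹).val * ((t : ((cmDatum L 2 (Matrix.of fun i j : Fin 2 => if i.val + j.val + 1 = 2 then (1 : L) else 0)).Local v × (cmDatum L 1 (Matrix.of fun i j : Fin 1 => if i.val + j.val + 1 = 1 then (1 : L) else 0)).Local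 v)).1.val.val : Matrix (Fin 2) (Fin 2) (LocalRing L v)) * P.val) 0 0) w, (((P⁻¹).val * ((t : ((cmDatum L 2 (Matrix.of fun i j : Fin 2 => if i.val + j.val + 1 = 2 then (1 : L) else 0)).Local v × (cmDatum L 1 (Matrix.of fun i j : Fin 1 => if i.val + j.val + 1 = 1 then (1 : L) else 0)).Local v)).1.val.val : Matrix (Fin 2) (Fin 2) (LocalRing L v)) * P.val) 1 1) w] : Fin 2 → (w.1.adicCompletion L)) 1) = valuation (w.1.adicCompletion L) ((ϖ : (w.1.adicCompletion L)) ^ (-WithZero.log (Valued.v ((((P⁻¹).val * ((t : ((cmDatum L 2 (Matrix.of fun i j : Fin 2 => if i.val + j.val + 1 = 2 then (1 : L) else 0)).Local v × (cmDatum L 1 (Matrix.of fun i j : Fin 1 => if i.val + j.val + 1 = 1 then (1 : L) else 0)).Local v)).1.val.val : Matrix (Fin 2) (Fin 2) (LocalRing L v)) * P.val) 0 0 - ((P⁻¹).val * ((t : ((cmDatum L 2 (Matrix.of fun i j : Fin 2 => if i.val + j.val + 1 = 2 then (1 : L) else 0)).Local v × (cmDatum L 1 (Matrix.of fun i j : Fin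 1 => if i.val + j.val + 1 = 1 then (1 : L) else 0)).Local v)).1.val.val : Matrix (Fin 2) (Fin 2) (LocalRing L v)) * P.val) 1 1) w))).toNat) := by
      rw [← v_eq_iff_valuation_eq, hn, map_pow]
    exact Nat.odd_iff.1 (odd_of_valuation_sub_eq_of_norm_one (galAdicCompletionMap (L := L) (IsCMField.complexConj L) hw) hϖ' hσϖ σO hσO' h2O hres (hu1 0) (hu1 1) (hval 0) (hval 1) hN' (by omega))
  -- per-piece bookkeeping: parity type, Haar mass, window value family
  obtain ⟨par, hpar⟩ : ∃ par : Fin n → ℕ, ∀ k, par k = if ε k = 0 then 0 else 1 := ⟨_, fun _ => rfl⟩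
  have hpar1 : ∀ k, par k ≤ 1 := fun k => by rw [hpar]; split_ifs <;> omega
  obtain ⟨r, hr'⟩ : ∃ r : Fin n → ℝ, ∀ k, r k = ν.real (((K₂ (ε k)).prod (⊤ : Subgroup ((cmDatum L 1 (Matrix.of fun i j : Fin 1 => if i.val + j.val + 1 = 1 then (1 : L) else 0)).Local v)) : Subgroup ((cmDatum L 2 (Matrix.of fun i j : Fin 2 => if i.val + j.val + 1 = 2 then (1 : L) else 0)).Local v × (cmDatum L 1 (Matrix.of fun i j : Fin 1 => if i.val + j.val + 1 = 1 then (1 : L) else 0)).Local v)) : Set ((cmDatum L 2 (Matrix.of fun i j : Fin 2 => if i.val + j.val + 1 = 2 then (1 : L) else 0)).Local v × (cmDatum L 1 (Matrix.of fun i j : Fin 1 => if i.val + j.val + 1 = 1 then (1 : L) else 0)).Local v)) := ⟨_, fun _ => rfl⟩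
  obtain ⟨X, hX⟩ : ∃ X : Fin n → ↥(Subgroup.centralizer ({t₀} : Set ((cmDatum L 2 (Matrix.of fun i j : Fin 2 => if i.val + j.val + 1 = 2 then (1 : L) else 0)).Local v × (cmDatum L 1 (Matrix.of fun i j : Fin 1 => if i.val + j.val + 1 = 1 then (1 : L) else 0)).Local v))) → ℕ → ℕ → ↥(unitaryGroupOfForm (galAdicCompletionMap (L := L) (IsCMField.complexConj L) hw) (placeForm (Matrix.of fun i j : Fin 2 => if i.val + j.val + 1 = 2 then (1 : L) else 0) w.1)), ∀ k t i b, X k t i b = if ε k = 0 then XE t i b else XV t i b := ⟨_, fun _ _ _ _ => rfl⟩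
  -- §e the PAIR of expansions of every piece, at `↑t` and at `e ↑t` (bits `b` and `1 − b`)
  have hpair : ∀ (k : Fin n) (t : ↥(Subgroup.centralizer ({t₀} : Set ((cmDatum L 2 (Matrix.of fun i j : Fin 2 => if i.val + j.val + 1 = 2 then (1 : L) else 0)).Local v × (cmDatum L 1 (Matrix.of fun i j : Fin 1 => if i.val + j.val + 1 = 1 then (1 : L) else 0)).Local v)))), IsRegularElt ((t : ((cmDatum L 2 (Matrix.of fun i j : Fin 2 => if i.val + j.val + 1 = 2 then (1 : L) else 0)).Local v × (cmDatum L 1 (Matrix.of fun i j : Fin 1 => if i.val + j.val + 1 = 1 then (1 : L) else 0)).Local v)).1.val : GL (Fin 2) (LocalRing L v)) → m₀ + 1 ≤ (-WithZero.log (Valued.v ((((P⁻¹).val * ((t : ((cmDatum L 2 (Matrix.of fun i j : Fin 2 => if i.val + j.val + 1 = 2 then (1 : L) else 0)).Local v × (cmDatum L 1 (Matrix.of fun i j : Fin 1 => if i.val + j.val + 1 = 1 then (1 : L) else 0)).Local v)).1.val.val : Matrix (Fin 2) (Fin 2) (LocalRing L v)) * P.val) 0 0 - ((P⁻¹).val *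 ((t : ((cmDatum L 2 (Matrix.of fun i j : Fin 2 => if i.val + j.val + 1 = 2 then (1 : L) else 0)).Local v × (cmDatum L 1 (Matrix.of fun i j : Fin 1 => if i.val + j.val + 1 = 1 then (1 : L) else 0)).Local v)).1.val.val : Matrix (Fin 2) (Fin 2) (LocalRing L v)) * P.val) 1 1) w))).toNat →
      ∃ b : ℕ → ℕ, (∀ i, b i ≤ 1) ∧
        (∫ y, φk k (y * (t : ((cmDatum L 2 (Matrix.of fun i j : Fin 2 => if i.val + j.val + 1 = 2 then (1 : L) else 0)).Local v × (cmDatum L 1 (Matrix.of fun i j : Fin 1 => if i.val + j.val + 1 = 1 then (1 : L) else 0)).Local v)) * y⁻¹) ∂ν) = r k • ((∑ j ∈ (Finset.range ((-WithZero.log (Valued.v ((((P⁻¹).val * ((t : ((cmDatum L 2 (Matrix.of fun i j : Fin 2 => if i.val + j.val + 1 = 2 then (1 : L) else 0)).Local v × (cmDatum L 1 (Matrix.of fun i j : Fin 1 => if i.val + j.val + 1 = 1 then (1 : L) else 0)).Local v)).1.val.val : Matrix (Fin 2) (Fin 2) (LocalRing L v)) * P.val) 0 0 - ((P⁻¹).val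 * ((t : ((cmDatum L 2 (Matrix.of fun i j : Fin 2 => if i.val + j.val + 1 = 2 then (1 : L) else 0)).Local v × (cmDatum L 1 (Matrix.of fun i j : Fin 1 => if i.val + j.val + 1 = 1 then (1 : L) else 0)).Local v)).1.val.val : Matrix (Fin 2) (Fin 2) (LocalRing L v)) * P.val) 1 1) w))).toNat + 1)).filter (fun j => j % 2 = par k ∧ j + (m₀ + 1) ≤ (-WithZero.log (Valued.v ((((P⁻¹).val * ((t : ((cmDatum L 2 (Matrix.of fun i j : Fin 2 => if i.val + j.val + 1 = 2 then (1 : L) else 0)).Local v × (cmDatum L 1 (Matrix.of fun i j : Fin 1 => if i.val + j.val + 1 = 1 then (1 : L) else 0)).Local v)).1.val.val : Matrix (Fin 2) (Fin 2) (LocalRing L v)) * P.val) 0 0 - ((P⁻¹).val * ((t : ((cmDatum L 2 (Matrix.of fun i j : Fin 2 => if i.val + j.val + 1 = 2 then (1 : L) else 0)).Local v × (cmDatum L 1 (Matrix.of fun i j : Fin 1 => if i.val + j.val + 1 = 1 then (1 : L) else 0)).Local v)).1.val.val : Matrix (Fin 2) (Fin 2) (LocalRing L v)) * P.val) 1 1)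 w))).toNat), (if j = 0 then 1 else 2 * (Nat.card (𝓞 ↥(maximalRealSubfield L) ⧸ v.asIdeal)) ^ (j / 2))) • φk k (E₂.symm (xm t), (t : ((cmDatum L 2 (Matrix.of fun i j : Fin 2 => if i.val + j.val + 1 = 2 then (1 : L) else 0)).Local v × (cmDatum L 1 (Matrix.of fun i j : Fin 1 => if i.val + j.val + 1 = 1 then (1 : L) else 0)).Local v)).2) +
          ∑ i ∈ Finset.range (m₀ + 1), (if i ≤ (-WithZero.log (Valued.v ((((P⁻¹).val * ((t : ((cmDatum L 2 (Matrix.of fun i j : Fin 2 => if i.val + j.val + 1 = 2 then (1 : L) else 0)).Local v × (cmDatum L 1 (Matrix.of fun i j : Fin 1 => if i.val + j.val + 1 = 1 then (1 : L) else 0)).Local v)).1.val.val : Matrix (Fin 2) (Fin 2) (LocalRing L v)) * P.val) 0 0 - ((P⁻¹).val * ((t : ((cmDatum L 2 (Matrix.of fun i j : Fin 2 => if i.val + j.val + 1 = 2 then (1 : L) else 0)).Local v × (cmDatum L 1 (Matrix.of fun i j : Fin 1 => if i.val + j.val + 1 = 1 then (1 : L) else 0)).Local v)).1.val.val : Matrix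 (Fin 2) (Fin 2) (LocalRing L v)) * P.val) 1 1) w))).toNat ∧ ((-WithZero.log (Valued.v ((((P⁻¹).val * ((t : ((cmDatum L 2 (Matrix.of fun i j : Fin 2 => if i.val + j.val + 1 = 2 then (1 : L) else 0)).Local v × (cmDatum L 1 (Matrix.of fun i j : Fin 1 => if i.val + j.val + 1 = 1 then (1 : L) else 0)).Local v)).1.val.val : Matrix (Fin 2) (Fin 2) (LocalRing L v)) * P.val) 0 0 - ((P⁻¹).val * ((t : ((cmDatum L 2 (Matrix.of fun i j : Fin 2 => if i.val + j.val + 1 = 2 then (1 : L) else 0)).Local v × (cmDatum L 1 (Matrix.of fun i j : Fin 1 => if i.val + j.val + 1 = 1 then (1 : L) else 0)).Local v)).1.val.val : Matrix (Fin 2) (Fin 2) (LocalRing L v)) * P.val) 1 1) w))).toNat - i) % 2 = par k then (if (-WithZero.log (Valued.v ((((P⁻¹).val * ((t : ((cmDatum L 2 (Matrix.of fun i j : Fin 2 => if i.val + j.val + 1 = 2 then (1 : L) else 0)).Local v × (cmDatum L 1 (Matrix.of fun i j : Fin 1 => if i.val + j.val + 1 = 1 then (1 : L) else 0)).Local v)).1.val.val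 : Matrix (Fin 2) (Fin 2) (LocalRing L v)) * P.val) 0 0 - ((P⁻¹).val * ((t : ((cmDatum L 2 (Matrix.of fun i j : Fin 2 => if i.val + j.val + 1 = 2 then (1 : L) else 0)).Local v × (cmDatum L 1 (Matrix.of fun i j : Fin 1 => if i.val + j.val + 1 = 1 then (1 : L) else 0)).Local v)).1.val.val : Matrix (Fin 2) (Fin 2) (LocalRing L v)) * P.val) 1 1) w))).toNat - i = 0 then 1 else 2 * (Nat.card (𝓞 ↥(maximalRealSubfield L) ⧸ v.asIdeal)) ^ (((-WithZero.log (Valued.v ((((P⁻¹).val * ((t : ((cmDatum L 2 (Matrix.of fun i j : Fin 2 => if i.val + j.val + 1 = 2 then (1 : L) else 0)).Local v × (cmDatum L 1 (Matrix.of fun i j : Fin 1 => if i.val + j.val + 1 = 1 then (1 : L) else 0)).Local v)).1.val.val : Matrix (Fin 2) (Fin 2) (LocalRing L v)) * P.val) 0 0 - ((P⁻¹).val * ((t : ((cmDatum L 2 (Matrix.of fun i j : Fin 2 => if i.val + j.val + 1 = 2 then (1 : L) else 0)).Local v × (cmDatum L 1 (Matrix.of fun i j : Fin 1 => if i.val +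 j.val + 1 = 1 then (1 : L) else 0)).Local v)).1.val.val : Matrix (Fin 2) (Fin 2) (LocalRing L v)) * P.val) 1 1) w))).toNat - i) / 2)) else 0) • φk k (E₂.symm (X k t i (b i)), (t : ((cmDatum L 2 (Matrix.of fun i j : Fin 2 => if i.val + j.val + 1 = 2 then (1 : L) else 0)).Local v × (cmDatum L 1 (Matrix.of fun i j : Fin 1 => if i.val + j.val + 1 = 1 then (1 : L) else 0)).Local v)).2)) ∧
        (∫ y, φk k (y * e (t : ((cmDatum L 2 (Matrix.of fun i j : Fin 2 => if i.val + j.val + 1 = 2 then (1 : L) else 0)).Local v × (cmDatum L 1 (Matrix.of fun i j : Fin 1 => if i.val + j.val + 1 = 1 then (1 : L) else 0)).Local v)) * y⁻¹) ∂ν) = r k • ((∑ j ∈ (Finset.range ((-WithZero.log (Valued.v ((((P⁻¹).val * ((t : ((cmDatum L 2 (Matrix.of fun i j : Fin 2 => if i.val + j.val + 1 = 2 then (1 : L) else 0)).Local v × (cmDatum L 1 (Matrix.of fun i j : Fin 1 => if i.val + j.val + 1 = 1 then (1 : L) else 0)).Local v)).1.val.val : Matrix (Fin 2) (Fin 2)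 (LocalRing L v)) * P.val) 0 0 - ((P⁻¹).val * ((t : ((cmDatum L 2 (Matrix.of fun i j : Fin 2 => if i.val + j.val + 1 = 2 then (1 : L) else 0)).Local v × (cmDatum L 1 (Matrix.of fun i j : Fin 1 => if i.val + j.val + 1 = 1 then (1 : L) else 0)).Local v)).1.val.val : Matrix (Fin 2) (Fin 2) (LocalRing L v)) * P.val) 1 1) w))).toNat + 1)).filter (fun j => j % 2 = par k ∧ j + (m₀ + 1) ≤ (-WithZero.log (Valued.v ((((P⁻¹).val * ((t : ((cmDatum L 2 (Matrix.of fun i j : Fin 2 => if i.val + j.val + 1 = 2 then (1 : L) else 0)).Local v × (cmDatum L 1 (Matrix.of fun i j : Fin 1 => if i.val + j.val + 1 = 1 then (1 : L) else 0)).Local v)).1.val.val : Matrix (Fin 2) (Fin 2) (LocalRing L v)) * P.val) 0 0 - ((P⁻¹).val * ((t : ((cmDatum L 2 (Matrix.of fun i j : Fin 2 => if i.val + j.val + 1 = 2 then (1 : L) else 0)).Local v × (cmDatum L 1 (Matrix.of fun i j : Fin 1 => if i.val + j.val + 1 = 1 then (1 : L) else 0)).Local v)).1.val.val : Matrix (Fin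 2) (Fin 2) (LocalRing L v)) * P.val) 1 1) w))).toNat), (if j = 0 then 1 else 2 * (Nat.card (𝓞 ↥(maximalRealSubfield L) ⧸ v.asIdeal)) ^ (j / 2))) • φk k (E₂.symm (xm t), (t : ((cmDatum L 2 (Matrix.of fun i j : Fin 2 => if i.val + j.val + 1 = 2 then (1 : L) else 0)).Local v × (cmDatum L 1 (Matrix.of fun i j : Fin 1 => if i.val + j.val + 1 = 1 then (1 : L) else 0)).Local v)).2) +
          ∑ i ∈ Finset.range (m₀ + 1), (if i ≤ (-WithZero.log (Valued.v ((((P⁻¹).val * ((t : ((cmDatum L 2 (Matrix.of fun i j : Fin 2 => if i.val + j.val + 1 = 2 then (1 : L) else 0)).Local v × (cmDatum L 1 (Matrix.of fun i j : Fin 1 => if i.val + j.val + 1 = 1 then (1 : L) else 0)).Local v)).1.val.val : Matrix (Fin 2) (Fin 2) (LocalRing L v)) * P.val) 0 0 - ((P⁻¹).val * ((t : ((cmDatum L 2 (Matrix.of fun i j : Fin 2 => if i.val + j.val + 1 = 2 then (1 : L) else 0)).Local v × (cmDatum L 1 (Matrix.of fun i j : Fin 1 => if i.val + j.val + 1 =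 1 then (1 : L) else 0)).Local v)).1.val.val : Matrix (Fin 2) (Fin 2) (LocalRing L v)) * P.val) 1 1) w))).toNat ∧ ((-WithZero.log (Valued.v ((((P⁻¹).val * ((t : ((cmDatum L 2 (Matrix.of fun i j : Fin 2 => if i.val + j.val + 1 = 2 then (1 : L) else 0)).Local v × (cmDatum L 1 (Matrix.of fun i j : Fin 1 => if i.val + j.val + 1 = 1 then (1 : L) else 0)).Local v)).1.val.val : Matrix (Fin 2) (Fin 2) (LocalRing L v)) * P.val) 0 0 - ((P⁻¹).val * ((t : ((cmDatum L 2 (Matrix.of fun i j : Fin 2 => if i.val + j.val + 1 = 2 then (1 : L) else 0)).Local v × (cmDatum L 1 (Matrix.of fun i j : Fin 1 => if i.val + j.val + 1 = 1 then (1 : L) else 0)).Local v)).1.val.val : Matrix (Fin 2) (Fin 2) (LocalRing L v)) * P.val) 1 1) w))).toNat - i) % 2 = par k then (if (-WithZero.log (Valued.v ((((P⁻¹).val * ((t : ((cmDatum L 2 (Matrix.of fun i j : Fin 2 => if i.val + j.val + 1 = 2 then (1 : L) else 0)).Local v × (cmDatum L 1 (Matrix.of fun i j : Fin 1 => if i.val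 + j.val + 1 = 1 then (1 : L) else 0)).Local v)).1.val.val : Matrix (Fin 2) (Fin 2) (LocalRing L v)) * P.val) 0 0 - ((P⁻¹).val * ((t : ((cmDatum L 2 (Matrix.of fun i j : Fin 2 => if i.val + j.val + 1 = 2 then (1 : L) else 0)).Local v × (cmDatum L 1 (Matrix.of fun i j : Fin 1 => if i.val + j.val + 1 = 1 then (1 : L) else 0)).Local v)).1.val.val : Matrix (Fin 2) (Fin 2) (LocalRing L v)) * P.val) 1 1) w))).toNat - i = 0 then 1 else 2 * (Nat.card (𝓞 ↥(maximalRealSubfield L) ⧸ v.asIdeal)) ^ (((-WithZero.log (Valued.v ((((P⁻¹).val * ((t : ((cmDatum L 2 (Matrix.of fun i j : Fin 2 => if i.val + j.val + 1 = 2 then (1 : L) else 0)).Local v × (cmDatum L 1 (Matrix.of fun i j : Fin 1 => if i.val + j.val + 1 = 1 then (1 : L) else 0)).Local v)).1.val.val : Matrix (Fin 2) (Fin 2) (LocalRing L v)) * P.val) 0 0 - ((P⁻¹).val * ((t : ((cmDatum L 2 (Matrix.of fun i j : Fin 2 => if i.val + j.val + 1 = 2 then (1 : L) else 0)).Local v ×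 (cmDatum L 1 (Matrix.of fun i j : Fin 1 => if i.val + j.val + 1 = 1 then (1 : L) else 0)).Local v)).1.val.val : Matrix (Fin 2) (Fin 2) (LocalRing L v)) * P.val) 1 1) w))).toNat - i) / 2)) else 0) • φk k (E₂.symm (X k t i (1 - b i)), (t : ((cmDatum L 2 (Matrix.of fun i j : Fin 2 => if i.val + j.val + 1 = 2 then (1 : L) else 0)).Local v × (cmDatum L 1 (Matrix.of fun i j : Fin 1 => if i.val + j.val + 1 = 1 then (1 : L) else 0)).Local v)).2)) := by
    intro k t hreg hmN
    rcases hε k with h0 | h1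
    · -- EDGE piece `K⁰`
      obtain ⟨b, hb1, -, hO, hO'⟩ := depthExpansion_pair_ramified_selfDual L v w hw ν t₀ P d ht₀ hP hd1 he h2 ϖ hϖ hσϖ σO hσO' hσσ hres u hvu hσu hηu' hηu hση hη
        E₂ hE₂' e he2 hconjE (K₂ 0) hdict0 (hK₂o 0) (hK₂c 0) (φk k) (by simpa only [h0] using hφkK k) (by simpa only [h0] using hφkinv k)
        Q hQ hQh hh hσh rQ hr hsq (m₀ + 1) (by omega) ((localCongruenceSubgroup 2 L w.1 m₀).subgroupOf (unitaryGroupOfForm (galAdicCompletionMap (L := L) (IsCMField.complexConj L) hw) (placeForm (Matrix.of fun i j : Fin 2 => if i.val + j.val + 1 = 2 then (1 : L) else 0) w.1))) hKmE (fun a x' y hy => hφm₀ k a x' y hy)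
        xm hxm XE hXE' t hreg hmN
      refine ⟨b, hb1, ?_, ?_⟩
      · simp only [hr', hX, hpar, if_pos h0]
        rw [h0]
        exact hO
      · simp only [hr', hX, hpar, if_pos h0]
        rw [h0]
        exact hO'
    · -- VERTEX piece `K♯`
      have hk0 : ¬ ε k = 0 := by rw [h1]; exact one_ne_zero
      obtain ⟨b, hb1, -, hO, hO'⟩ := depthExpansion_pair_ramified_modular L v w hw ν t₀ P d ht₀ hP hd1 he h2 ϖ hϖ hσϖ σO hσO' hσσ hres u hvu hσu hηu' hηu hση hη
        (glDiagonal 2 (w.1.adicCompletion L) ![1, ϖ]) hD E₂ hE₂' e he2 hconjE (K₂ 1) hdict1 (hK₂o 1) (hK₂c 1) (φk k) (by simpa only [h1] using hφkK k) (by simpa only [h1] using hφkinv k)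
        Q hQ hQh hh hσh rQ hr hsq (m₀ + 1) (by omega) ((localCongruenceSubgroup 2 L w.1 m₀).subgroupOf (unitaryGroupOfForm (galAdicCompletionMap (L := L) (IsCMField.complexConj L) hw) (placeForm (Matrix.of fun i j : Fin 2 => if i.val + j.val + 1 = 2 then (1 : L) else 0) w.1))) hKmV (fun a x' y hy => hφm₀ k a x' y hy)
        xm hxm XV hXV' t hreg hmN
      refine ⟨b, hb1, ?_, ?_⟩
      · simp only [hr', hX, hpar, if_neg hk0]
        rw [h1]
        exact hO
      · simp only [hr', hX, hpar, if_neg hk0]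
        rw [h1]
        exact hO'
  -- §f the pointwise piece sums at `↑t` and at `e ↑t` (★ I-5c twice; trace bound and properness ★ asm §2)
  have hsumS : ∀ t : ↥(Subgroup.centralizer ({t₀} : Set ((cmDatum L 2 (Matrix.of fun i j : Fin 2 => if i.val + j.val + 1 = 2 then (1 : L) else 0)).Local v × (cmDatum L 1 (Matrix.of fun i j : Fin 1 => if i.val + j.val + 1 = 1 then (1 : L) else 0)).Local v))), IsRegularElt ((t : ((cmDatum L 2 (Matrix.of fun i j : Fin 2 => if i.val + j.val + 1 = 2 then (1 : L) else 0)).Local v × (cmDatum L 1 (Matrix.of fun i j : Fin 1 => if i.val + j.val + 1 = 1 then (1 : L) else 0)).Local v)).1.val : GL (Fin 2) (LocalRing L v)) →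
      (∫ y, f (y * (t : ((cmDatum L 2 (Matrix.of fun i j : Fin 2 => if i.val + j.val + 1 = 2 then (1 : L) else 0)).Local v × (cmDatum L 1 (Matrix.of fun i j : Fin 1 => if i.val + j.val + 1 = 1 then (1 : L) else 0)).Local v)) * y⁻¹) ∂ν) + (∫ y, f (y * e (t : ((cmDatum L 2 (Matrix.of fun i j : Fin 2 => if i.val + j.val + 1 = 2 then (1 : L) else 0)).Local v × (cmDatum L 1 (Matrix.of fun i j : Fin 1 => if i.val + j.val + 1 = 1 then (1 : L) else 0)).Local v)) * y⁻¹) ∂ν) =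
        ∑ k, ((∫ y, φk k (y * (t : ((cmDatum L 2 (Matrix.of fun i j : Fin 2 => if i.val + j.val + 1 = 2 then (1 : L) else 0)).Local v × (cmDatum L 1 (Matrix.of fun i j : Fin 1 => if i.val + j.val + 1 = 1 then (1 : L) else 0)).Local v)) * y⁻¹) ∂ν) + ∫ y, φk k (y * e (t : ((cmDatum L 2 (Matrix.of fun i j : Fin 2 => if i.val + j.val + 1 = 2 then (1 : L) else 0)).Local v × (cmDatum L 1 (Matrix.of fun i j : Fin 1 => if i.val + j.val + 1 = 1 then (1 : L) else 0)).Local v)) * y⁻¹) ∂ν) := by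
    intro t hreg
    have h1 : Valued.v ((((t : ((cmDatum L 2 (Matrix.of fun i j : Fin 2 => if i.val + j.val + 1 = 2 then (1 : L) else 0)).Local v × (cmDatum L 1 (Matrix.of fun i j : Fin 1 => if i.val + j.val + 1 = 1 then (1 : L) else 0)).Local v)).1.val.val : Matrix (Fin 2) (Fin 2) (LocalRing L v)).trace) w) ≤ 1 :=
      valued_trace_le_one_of_mem_centralizer L v w hw t₀ P d ht₀ hP hd1 (t : ((cmDatum L 2 (Matrix.of fun i j : Fin 2 => if i.val + j.val + 1 = 2 then (1 : L) else 0)).Local v × (cmDatum L 1 (Matrix.of fun i j : Fin 1 => if i.val + j.val + 1 = 1 then (1 : L) else 0)).Local v)) t.2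
    have h2' : Valued.v ((((e (t : ((cmDatum L 2 (Matrix.of fun i j : Fin 2 => if i.val + j.val + 1 = 2 then (1 : L) else 0)).Local v × (cmDatum L 1 (Matrix.of fun i j : Fin 1 => if i.val + j.val + 1 = 1 then (1 : L) else 0)).Local v))).1.val.val : Matrix (Fin 2) (Fin 2) (LocalRing L v)).trace) w) ≤ 1 := by
      have h := mem_setOf_valued_trace_le_one_of_isLocalStablyConjH L v w hw t₀ P d ht₀ hP hd1 (t : ((cmDatum L 2 (Matrix.of fun i j : Fin 2 => if i.val + j.val + 1 = 2 then (1 : L) else 0)).Local v × (cmDatum L 1 (Matrix.of fun i j : Fin 1 => if i.val + j.val + 1 = 1 then (1 : L) else 0)).Local v)) t.2 (hest t hreg).1 1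
      simpa only [one_mul, inv_one, mul_one, Set.mem_setOf_eq] using h
    rw [hint (t : ((cmDatum L 2 (Matrix.of fun i j : Fin 2 => if i.val + j.val + 1 = 2 then (1 : L) else 0)).Local v × (cmDatum L 1 (Matrix.of fun i j : Fin 1 => if i.val + j.val + 1 = 1 then (1 : L) else 0)).Local v)) h1 (isCompact_setOf_conj_mem_of_mem_centralizer L v w hw t₀ P d ht₀ hP hd1 (t : ((cmDatum L 2 (Matrix.of fun i j : Fin 2 => if i.val + j.val + 1 = 2 then (1 : L) else 0)).Local v × (cmDatum L 1 (Matrix.of fun i j : Fin 1 => if i.val + j.val + 1 = 1 then (1 : L) else 0)).Local v)) t.2 hreg),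
      hint (e (t : ((cmDatum L 2 (Matrix.of fun i j : Fin 2 => if i.val + j.val + 1 = 2 then (1 : L) else 0)).Local v × (cmDatum L 1 (Matrix.of fun i j : Fin 1 => if i.val + j.val + 1 = 1 then (1 : L) else 0)).Local v))) h2' (isCompact_setOf_conj_map_mem_of_mem_centralizer L v w hw t₀ P d ht₀ hP hd1 e (t : ((cmDatum L 2 (Matrix.of fun i j : Fin 2 => if i.val + j.val + 1 = 2 then (1 : L) else 0)).Local v × (cmDatum L 1 (Matrix.of fun i j : Fin 1 => if i.val + j.val + 1 = 1 then (1 : L) else 0)).Local v)) t.2 hreg), ← Finset.sum_add_distrib]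
  -- THE STABLE FOLD: ★ T6-1u′ (adapter) ∘ pieces ∘ §1 regrouping (the two sheets add up, ★ T6-1r §1)
  refine ⟨m₀ + 1, fun π t => ∑ k, (if par k = π then ((r k : ℝ) : ℂ) * φk k (E₂.symm (xm t), ((t : ((cmDatum L 2 (Matrix.of fun i j : Fin 2 => if i.val + j.val + 1 = 2 then (1 : L) else 0)).Local v × (cmDatum L 1 (Matrix.of fun i j : Fin 1 => if i.val + j.val + 1 = 1 then (1 : L) else 0)).Local v))).2) else 0),
    fun i t => ∑ k, (if par k = (i + 1) % 2 then ((r k : ℝ) : ℂ) * (φk k (E₂.symm (X k t i 0), ((t : ((cmDatum L 2 (Matrix.of fun i j : Fin 2 => if i.val + j.val + 1 = 2 then (1 : L) else 0)).Local v × (cmDatum L 1 (Matrix.of fun i j : Fin 1 => if i.val + j.val + 1 = 1 then (1 : L) else 0)).Local v))).2) + φk k (E₂.symm (X k t i 1), ((t : ((cmDatum L 2 (Matrix.of fun i j : Fin 2 => if i.val + j.val + 1 = 2 then (1 : L) else 0)).Local v × (cmDatum L 1 (Matrix.of fun i j : Fin 1 => if i.val + j.val + 1 = 1 then (1 : L)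 else 0)).Local v))).2)) else 0), ?_, ?_, ?_⟩
  · -- `Φm π` is locally constant (★ S3 with the scalar matrix `1`)
    intro π
    refine isLocallyConstant_finset_sum Finset.univ (fun k t => if par k = π then ((r k : ℝ) : ℂ) * φk k (E₂.symm (xm t), ((t : ((cmDatum L 2 (Matrix.of fun i j : Fin 2 => if i.val + j.val + 1 = 2 then (1 : L) else 0)).Local v × (cmDatum L 1 (Matrix.of fun i j : Fin 1 => if i.val + j.val + 1 = 1 then (1 : L) else 0)).Local v))).2) else 0) fun k _ => ?_
    by_cases hp : par k = π
    · simp only [if_pos hp]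
      exact isLocallyConstant_const_mul (((r k : ℝ) : ℂ))
        (isLocallyConstant_apply_symm_frameScalar_snd_of_ne_zero L v w hw t₀ P d ht₀ hP hd1 E₂ (φk k) (hφk k).1 (ϖ : (w.1.adicCompletion L)) hϖ0 (m₀ + 1) (hS3 k) 1 (1 : Matrix (Fin 2) (Fin 2) (w.1.adicCompletion L)) xm hxm)
    · simp only [if_neg hp]
      exact IsLocallyConstant.const 0
  · -- each `Φ i` is locally constant (★ S3 with the window matrices `ME i b` ∕ `MV i b`)
    intro i _
    refine isLocallyConstant_finset_sum Finset.univ (fun k t => if par k = (i + 1) % 2 then ((r k : ℝ) : ℂ) * (φk k (E₂.symm (X k t i 0), ((t : ((cmDatum L 2 (Matrix.of fun i j : Fin 2 => if i.val + j.val + 1 = 2 then (1 : L) else 0)).Local v × (cmDatum L 1 (Matrix.of fun i j : Fin 1 => if i.val + j.val + 1 = 1 then (1 : L) else 0)).Local v))).2) + φk k (E₂.symm (X k t i 1), ((t : ((cmDatum L 2 (Matrix.of fun i j : Fin 2 => if i.val + j.val + 1 = 2 then (1 : L) else 0)).Local v × (cmDatum L 1 (Matrix.of fun i j : Fin 1 =>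 if i.val + j.val + 1 = 1 then (1 : L) else 0)).Local v))).2)) else 0)
      fun k _ => ?_
    by_cases hp : par k = (i + 1) % 2
    · simp only [if_pos hp]
      refine isLocallyConstant_const_mul (((r k : ℝ) : ℂ)) ?_
      have hb : ∀ bb : ℕ, IsLocallyConstant (fun t : ↥(Subgroup.centralizer ({t₀} : Set ((cmDatum L 2 (Matrix.of fun i j : Fin 2 => if i.val + j.val + 1 = 2 then (1 : L) else 0)).Local v × (cmDatum L 1 (Matrix.of fun i j : Fin 1 => if i.val + j.val + 1 = 1 then (1 : L) else 0)).Local v))) => φk k (E₂.symm (X k t i bb), ((t : ((cmDatum L 2 (Matrix.of fun i j : Fin 2 => if i.val + j.val + 1 = 2 then (1 : L) else 0)).Local v × (cmDatum L 1 (Matrix.of fun i j : Fin 1 => if i.val + j.val + 1 = 1 then (1 : L) else 0)).Local v))).2)) := by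
        intro bb
        rcases hε k with h0 | h1
        · have hfun : (fun t : ↥(Subgroup.centralizer ({t₀} : Set ((cmDatum L 2 (Matrix.of fun i j : Fin 2 => if i.val + j.val + 1 = 2 then (1 : L) else 0)).Local v × (cmDatum L 1 (Matrix.of fun i j : Fin 1 => if i.val + j.val + 1 = 1 then (1 : L) else 0)).Local v))) => φk k (E₂.symm (X k t i bb), ((t : ((cmDatum L 2 (Matrix.of fun i j : Fin 2 => if i.val + j.val + 1 = 2 then (1 : L) else 0)).Local v × (cmDatum L 1 (Matrix.of fun i j : Fin 1 => if i.val + j.val + 1 = 1 then (1 : L) else 0)).Local v))).2)) = (fun t : ↥(Subgroup.centralizer ({t₀} : Set ((cmDatum L 2 (Matrix.of fun i j : Fin 2 => if i.val + j.val + 1 = 2 then (1 : L) else 0)).Local v × (cmDatum L 1 (Matrix.of fun i j : Fin 1 => if i.val + j.val + 1 = 1 then (1 : L) else 0)).Local v))) => φk k (E₂.symm (XE t i bb), ((t : ((cmDatum L 2 (Matrix.of fun i j : Fin 2 => if i.val + j.val + 1 = 2 then (1 : L) else 0)).Local v × (cmDatum L 1 (Matrix.of fun i j : Fin 1 => if i.val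 + j.val + 1 = 1 then (1 : L) else 0)).Local v))).2)) := by
            funext t; rw [hX, if_pos h0]
          rw [hfun]
          exact isLocallyConstant_apply_symm_frameScalar_snd_of_ne_zero L v w hw t₀ P d ht₀ hP hd1 E₂ (φk k) (hφk k).1 (ϖ : (w.1.adicCompletion L)) hϖ0 (m₀ + 1) (hS3 k) 1 (ME i bb)
            (fun t => XE t i bb) (fun t => hXEM t i bb)
        · have hk0 : ¬ ε k = 0 := by rw [h1]; exact one_ne_zero
          have hfun : (fun t : ↥(Subgroup.centralizer ({t₀} : Set ((cmDatum L 2 (Matrix.of fun i j : Fin 2 => if i.val + j.val + 1 = 2 then (1 : L) else 0)).Local v × (cmDatum L 1 (Matrix.of fun i j : Fin 1 => if i.val + j.val + 1 = 1 then (1 : L) else 0)).Local v))) => φk k (E₂.symm (X k t i bb), ((t : ((cmDatum L 2 (Matrix.of fun i j : Fin 2 => if i.val + j.val + 1 = 2 then (1 : L) else 0)).Local v × (cmDatum L 1 (Matrix.of fun i j : Fin 1 => if i.val + j.val + 1 = 1 then (1 : L) else 0)).Local v))).2)) = (fun t : ↥(Subgroup.centralizer ({t₀} : Set ((cmDatum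 L 2 (Matrix.of fun i j : Fin 2 => if i.val + j.val + 1 = 2 then (1 : L) else 0)).Local v × (cmDatum L 1 (Matrix.of fun i j : Fin 1 => if i.val + j.val + 1 = 1 then (1 : L) else 0)).Local v))) => φk k (E₂.symm (XV t i bb), ((t : ((cmDatum L 2 (Matrix.of fun i j : Fin 2 => if i.val + j.val + 1 = 2 then (1 : L) else 0)).Local v × (cmDatum L 1 (Matrix.of fun i j : Fin 1 => if i.val + j.val + 1 = 1 then (1 : L) else 0)).Local v))).2)) := by
            funext t; rw [hX, if_neg hk0]
          rw [hfun]
          exact isLocallyConstant_apply_symm_frameScalar_snd_of_ne_zero L v w hw t₀ P d ht₀ hP hd1 E₂ (φk k) (hφk k).1 (ϖ : (w.1.adicCompletion L)) hϖ0 (m₀ + 1) (hS3 k) 1 (MV i bb)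
            (fun t => XV t i bb) (fun t => hXVM t i bb)
      exact (hb 0).add (hb 1)
    · simp only [if_neg hp]
      exact IsLocallyConstant.const 0
  · -- the identity: adapter, pieces, the two sheets, regrouping
    intro t hRt hmN
    have hreg : IsRegularElt (((t : ((cmDatum L 2 (Matrix.of fun i j : Fin 2 => if i.val + j.val + 1 = 2 then (1 : L) else 0)).Local v × (cmDatum L 1 (Matrix.of fun i j : Fin 1 => if i.val + j.val + 1 = 1 then (1 : L) else 0)).Local v))).1.val : GL (Fin 2) (LocalRing L v)) := hReg _ hRt
    rw [stableOrbitalIntegralRel_eq_integral_add_integral_of_frame L v hv ν m Reg hReg hconj hstab hm f hf t₀ P d ht₀ hP hd1 t hRt (e (t : ((cmDatum L 2 (Matrix.of fun i j : Fin 2 => if i.val + j.val + 1 = 2 then (1 : L) else 0)).Local v × (cmDatum L 1 (Matrix.of fun i j : Fin 1 => if i.val + j.val + 1 = 1 then (1 : L) else 0)).Local v))) (hest t hreg).1 (hest t hreg).2,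
      hsumS t hreg]
    choose b hb1 hO hO' using fun k => hpair k t hreg hmN
    exact sum_pieces_eq_parityGrouped (Nat.card (𝓞 ↥(maximalRealSubfield L) ⧸ v.asIdeal)) hmN (hNodd t hreg hmN) par hpar1 r (fun k => φk k (E₂.symm (xm t), ((t : ((cmDatum L 2 (Matrix.of fun i j : Fin 2 => if i.val + j.val + 1 = 2 then (1 : L) else 0)).Local v × (cmDatum L 1 (Matrix.of fun i j : Fin 1 => if i.val + j.val + 1 = 1 then (1 : L) else 0)).Local v))).2))
      (fun k i bb => φk k (E₂.symm (X k t i bb), ((t : ((cmDatum L 2 (Matrix.of fun i j : Fin 2 => if i.val + j.val + 1 = 2 then (1 : L) else 0)).Local v × (cmDatum L 1 (Matrix.of fun i j : Fin 1 => if i.val + j.val + 1 = 1 then (1 : L) else 0)).Local v))).2)) (fun k => ∫ y, φk k (y * (t : ((cmDatum L 2 (Matrix.of fun i j : Fin 2 => if i.val + j.val + 1 = 2 then (1 : L) else 0)).Local v × (cmDatum L 1 (Matrix.of fun i j : Fin 1 => if i.val + j.val + 1 = 1 then (1 : L) else 0)).Local v)) * y⁻¹) ∂ν) (fun k => ∫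 y, φk k (y * e (t : ((cmDatum L 2 (Matrix.of fun i j : Fin 2 => if i.val + j.val + 1 = 2 then (1 : L) else 0)).Local v × (cmDatum L 1 (Matrix.of fun i j : Fin 1 => if i.val + j.val + 1 = 1 then (1 : L) else 0)).Local v)) * y⁻¹) ∂ν)
      b hb1 hO hO'

end StableHead

end Literature.NumberTheory.Rogawski1990

end
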